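import Literature.NumberTheory.EllipticCurves.MatarNekovar2019.IrreducibleOverQuadraticField
import Literature.NumberTheory.EllipticCurves.SupersingularIrreducibleProofs
import Literature.NumberTheory.EllipticCurves.SerreOpenImageOrdinaryInertiaProofs
import Literature.NumberTheory.EllipticCurves.SerreOpenImageOfLocalInputProofs
import Literature.NumberTheory.EllipticCurves.SerreOpenImageDeterminantProofs
import Literature.NumberTheory.EllipticCurves.SupersingularDensitySerreTraceProofs
import Literature.NumberTheory.EllipticCurves.TateModuleGaloisTransportProofs
import Literature.NumberTheory.EllipticCurves.Rank1Residual.GVParityTwistProofs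
import Literature.NumberTheory.EllipticCurves.OpenImageMazurAssemblyProofs
import Literature.NumberTheory.EllipticCurves.GlobalMinimalModelProofs
import Literature.NumberTheory.EllipticCurves.ModularityVersionApProofs
import Literature.NumberTheory.EllipticCurves.RootNumberSmulProofs
import Literature.NumberTheory.EllipticCurves.CMNewformOfHeckeCharacterProofs
import Literature.NumberTheory.Automorphic.ReciprocityGLnDescentProofs
import Literature.NumberTheory.Automorphic.LanglandsTetrahedral
import Literature.NumberTheory.NumberFields.ArtinMapDecompositionInertia
import Literature.NumberTheory.GaloisRepresentations.GlobalArtinMapOfCharactersProofs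
import Literature.NumberTheory.GaloisRepresentations.ArtinRestriction
import Literature.NumberTheory.GaloisRepresentations.ModNCyclotomicCharacter
import Literature.NumberTheory.GaloisRepresentations.IntegralGaloisActionProofs
import Literature.NumberTheory.GaloisRepresentations.DegreeOnePrimesFixedField
import Mathlib.NumberTheory.NumberField.ExistsRamified
import HarnessLib

/-!
# Matar–Nekovář 2019, Proposition 5.26 (2) is a THEOREM: `E[p]` irreducible over `ℚ` stays
# irreducible over every quadratic field `K` with `(N_E, d_K) = 1` (`p` odd)

`Proofs`-style file (THEOREMS ONLY: no definition, no named fact, no instance), topic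
`NumberTheory/EllipticCurves`: the discharge
`prop526_hasIrreducibleModPGaloisRep_baseChange_holds` of the named fact
`Literature.NumberTheory.EllipticCurves.MatarNekovar2019.prop526_hasIrreducibleModPGaloisRep_baseChange`
(A. Matar, J. Nekovář, J. Théor. Nombres Bordeaux **31** (2019), Prop. 5.26 (2), p. 492, proof
p. 493), following the printed proof:

> "If `ρ` is irreducible but `ρ|_{G_K}` is not, then `ρ|_{G_K}` is semisimple (since `G_K` is a
> normal subgroup of `G_ℚ`) and its image is contained in a split Cartan subgroup `C_s` of
> `GL₂(𝔽_p)`. Moreover, `ρ(G_ℚ) ≠ ρ(G_K)`, hence `D_K = p*` and `p ∤ N`, which means that `E` has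
> good reduction at `p`. If the reduction at `p` is supersingular, then `ρ(G_{ℚ_p}) = N(C_ns)` …
> which is impossible. If the reduction at `p` is ordinary, then the restriction of `ρ` to the
> inertia group `I_p ⊂ G_{ℚ_p}` is given by `(χ_{p,ℚ_p} ∗; 0 1)`, by [27, Prop. 11]. … As a
> result, `χ_{p,K_𝔭}|_{I_𝔭} = 1`, which implies that `χ²_{p,ℚ_p}(I_p) = 1`, `p = 3` and
> `K = ℚ(√−3)`. In this case … `ρ(G_ℚ) ≃ (ℤ/2ℤ)^a` …, which contradicts the irreducibility of `ρ`."

## The argument as formalised (same architecture; group theory done inside `Γ_ℚ`)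

Write `H = Gal(ℚ̄/K) ≤ Γ_ℚ` (the image of the restriction `Γ_K → Γ_ℚ`, open of index `2`).
* §1 (transport) If `E_K[p]` is reducible, `E[p] = E(ℚ̄)[p]` contains an `H`-stable line `Φ₀`
  (`exists_addEquiv_geomPoints_baseChange`).
* §2 ("`ρ(G_K) ⊂ C_s`, `ρ(G_ℚ) ⊂ N(C_s)`, `ρ(G_ℚ) ≠ ρ(G_K)`") By irreducibility over `ℚ` some
  `g ∈ Γ_ℚ` moves `Φ₀`; `Φ₁ = g Φ₀` is again `H`-stable (`H` is normal), and the stabiliser `U` of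
  `Φ₀` in `Γ_ℚ` is EXACTLY `H` (it contains `H`, has index `≤ 2`, and is not everything); the
  elements outside `U` swap `Φ₀` and `Φ₁`; every square lies in `U`.
* §3 ("`D_K = p*`": the ramification of `K`) `U = H` contains the inertia groups `I_𝔔 ≤ Γ_ℚ` at
  every prime `q ≠ p`: at a good `q` because `E[p]` is unramified there (Néron–Ogg–Shafarevich,
  `galoisRepTorsion_eq_one_of_mem_inertia_prime`), at a bad `q ∣ N` because `q ∤ d_K`, i.e. `q`
  is unramified in `K` (`inertia_le_range_absGaloisRestrict`, Mathlib
  `NumberField.not_dvd_discr_iff_forall_mem`). If also `p ∣ N` the same holds at `p`, and then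
  `K/ℚ` would be unramified everywhere — impossible for a quadratic field (Minkowski,
  `NumberField.exists_not_isUnramifiedAt_int`; §0 `not_forall_inertia_le_of_index_two`). So
  `p ∤ N`: good reduction at `p` (for a global minimal model, `hasGlobalMinimalModel_rat_holds`).
* §4 (Serre 1972 Prop. 12) Supersingular `p`: the inertia image is cyclic of order `p² − 1`
  (`isCyclic_and_card_inertia_map_of_dvd_frobeniusTrace`); the square of a generator lies in `U`,
  acts on `Φ₀` and `E[p]/Φ₀` by scalars, so its `(p−1)`-st power is unipotent: `p² − 1 ∣ 2p(p−1)`,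
  absurd.
* §5 (Serre 1972 Prop. 11) Ordinary `p ≥ 5`: inertia acts through `(χ ∗; 0 1)` on a line
  `X = 𝔽_p v₀` (`exists_line_of_not_dvd_frobeniusTrace_of_mem_primesAbove`) with `χ(I) = 𝔽_pˣ`
  (`exists_mem_inertia_smul_eq_of_sub_mem_line`); for `τ` with `χ(τ) = 2` (`2² ≠ 1` as `p ≥ 5`)
  the square `τ² ∈ U` has exactly the two stable lines `X` and `ker(τ² − 1)`, so `X ∈ {Φ₀, Φ₁}`
  and the whole inertia group (which stabilises `X`) lies in `U` — `K` unramified at `p` too,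
  contradiction as in §3 ("`χ²(I_p) = 1` forces `p = 3`").
* §6 Ordinary `p = 3` (`false_of_ordinary_three`): `det ρ̄ = χ̄₃` read in a basis
  (`modPCyclotomicCharacter_eq_det_of_basis`, from the tree's symplectic frame
  `exists_frame_galoisRepTorsion_rat`); an inertia element at `𝔓 ∣ 3` with `χ̄₃ = 1` is
  unipotent in Serre's basis, so of order `3` on `E[3]`, so in `U` (squares lie in `U`;
  `mem_of_mem_inertia_of_modPCyclotomicCharacter_eq_one`). With
  `V = ker χ̄₃ = Gal(ℚ̄/ℚ(√−3))` (open, index `2`): all inertia at `q ≠ 3` lies in `U ∩ V`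
  (`modNCyclotomicCharacter_eq_one_of_mem_inertia`); if the inertia groups at `3` lie in `U`, `K`
  is unramified everywhere; otherwise on them membership in `U` and in `V` agree, so for `U ≠ V`
  the third index-`2` subgroup `{σ : σ ∈ U ↔ σ ∈ V}` contains ALL inertia groups (§0 again), and
  `U = V` ("`K = ℚ(√−3)`") forces `ρ̄(U) ⊂ C_s ∩ SL₂(𝔽₃) = {±1}` and `σ ∉ U` to act by
  `±(0 1; 1 0)` in a basis `(P₀, g P₀)`, so the line `𝔽₃ (P₀ + g P₀)` is `Γ_ℚ`-stable —
  contradicting irreducibility over `ℚ` ("`ρ(G_ℚ) ≃ (ℤ/2ℤ)^a`";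
  `false_of_forall_mem_iff_modPCyclotomicCharacter_eq_one`).
* §6c Assembly: `not_exists_line` (`p ≠ 2`), `hasIrreducibleModPGaloisRep_baseChange_of_coprime`
  (reduction to a global minimal model) and the discharge
  `prop526_hasIrreducibleModPGaloisRep_baseChange_holds`.

References: [MatarNekovar2019] Prop. 5.26 (2) (p. 492) and its proof (p. 493); [Serre1972]
J.-P. Serre, Invent. Math. 15 (1972), §1.11 Prop. 11 and Cor., Prop. 12; §4.2 Lemme 2.
-/

set_option autoImplicit false

noncomputable section

open scoped Classical NumberField Pointwise

open WeierstrassCurve Field IsDedekindDomain NumberField Rat.HeightOneSpectrum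
  Literature.NumberTheory.EllipticCurves Literature.NumberTheory.GaloisRepresentations

universe u

namespace Literature.NumberTheory.EllipticCurves.MatarNekovar2019

/-! ### §0 No quadratic field is unramified everywhere (Minkowski), in `Γ_ℚ`-currency -/

/-- A prime of `\bar ℤ_K` above a given prime ideal of `𝓞 L`, for a number field `L ⊆ K̄`
(integrality of `\bar ℤ_K` over `𝓞 L`). [folklore] -/
private theorem exists_isPrime_comap_ringOfIntegersToIntegralClosure_eq {K : Type} [Field K]
    [NumberField K] (L : IntermediateField K (AlgebraicClosure K)) (Q : Ideal (𝓞 L))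
    [Q.IsPrime] :
    ∃ 𝔓 : Ideal (absIntegers (𝓞 K) K), 𝔓.IsPrime ∧
      𝔓.comap (EllipticCurves.ringOfIntegersToIntegralClosure (k := K)
        (Ω := AlgebraicClosure K) L) = Q := by
  set φ : 𝓞 L →+* absIntegers (𝓞 K) K :=
    EllipticCurves.ringOfIntegersToIntegralClosure (k := K) (Ω := AlgebraicClosure K) L with hφ
  have hφalg : ∀ x : 𝓞 K, φ (algebraMap (𝓞 K) (𝓞 L) x) =
      algebraMap (𝓞 K) (absIntegers (𝓞 K) K) x := fun x ↦ rfl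
  letI : Algebra (𝓞 L) (absIntegers (𝓞 K) K) := φ.toAlgebra
  haveI : IsScalarTower (𝓞 K) (𝓞 L) (absIntegers (𝓞 K) K) :=
    IsScalarTower.of_algebraMap_eq fun x ↦ (hφalg x).symm
  haveI : Algebra.IsIntegral (𝓞 L) (absIntegers (𝓞 K) K) :=
    ⟨fun x ↦ (Algebra.IsIntegral.isIntegral (R := 𝓞 K) x).tower_top⟩
  obtain ⟨𝔓, -, h𝔓prime, h𝔓Q⟩ := Ideal.exists_ideal_over_prime_of_isIntegral Q
    (⊥ : Ideal (absIntegers (𝓞 K) K))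
    (fun x hx ↦ by
      rw [Ideal.mem_comap, Ideal.mem_bot] at hx
      have hx0 : x = 0 :=
        EllipticCurves.ringOfIntegersToIntegralClosure_injective L (hx.trans (map_zero _).symm)
      rw [hx0]
      exact Q.zero_mem)
  exact ⟨𝔓, h𝔓prime, h𝔓Q⟩

/-- **No open subgroup of index `2` of `Γ_ℚ` contains every inertia group** — `ℚ` has no
everywhere unramified quadratic extension (Minkowski: `|d_L| > 1` for `L ≠ ℚ`, Mathlib
`NumberField.exists_not_isUnramifiedAt_int`). For such `H`, the fixed field `L = ℚ̄^H` is a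
quadratic number field with `Gal(ℚ̄/L) = H`; the inertia group in `Gal(L/ℚ)` of a prime `Q` of
`𝓞 L` is the restriction of the absolute inertia group of a prime `𝔓 ∣ Q` of `\bar ℤ` (Serre,
*Local Fields* I §7 Prop. 22 (b); tree `inertia_comap_ringOfIntegers_eq_map_absRestrictNormalHom`),
which dies in `Gal(L/ℚ)` when `I_𝔓 ≤ H`; so every `e(Q) = #I(Q) = 1` (Mathlib
`Ideal.card_inertia_eq_ramificationIdxIn`), i.e. `L/ℚ` is unramified everywhere.
[cite: NeukirchANT1999, Ch. III Thm. (2.17) (Minkowski: every number field other than ℚ is ramified)] -/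
theorem not_forall_inertia_le_of_index_two (H : Subgroup (absoluteGaloisGroup ℚ))
    (hopen : IsOpen (H : Set (absoluteGaloisGroup ℚ))) (hind : H.index = 2) :
    ¬ ∀ (𝔓 : Ideal (absIntegers (𝓞 ℚ) ℚ)), 𝔓.IsMaximal →
        𝔓.inertia (absoluteGaloisGroup ℚ) ≤ H := by
  intro hall
  haveI : Algebra.IsAlgebraic ℚ (AlgebraicClosure ℚ) := AlgebraicClosure.isAlgebraic ℚ
  haveI : Normal ℚ (AlgebraicClosure ℚ) :=
    @IsAlgClosure.normal ℚ (AlgebraicClosure ℚ) _ _ (AlgebraicClosure.instAlgebra ℚ) inferInstance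
  haveI : IsGalois ℚ (AlgebraicClosure ℚ) :=
    @IsAlgClosure.isGalois ℚ (AlgebraicClosure ℚ) _ _ (AlgebraicClosure.instAlgebra ℚ) inferInstance
      inferInstance
  haveI hHn : H.Normal := Subgroup.normal_of_index_eq_two hind
  -- the fixed field `L = ℚ̄^H`; instances are kept in BOTH `ℚ`-algebra conventions (the structural
  -- `IntermediateField.algebra` one produced by the general lemmas, and the one instance search
  -- finds on `↥L` in this file), which are definitionally equal
  set L := IntermediateField.fixedField H with hLdef
  have hLH : L.fixingSubgroup = H := fixingSubgroup_fixedField_of_isOpen H hopen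
  haveI hfd' := finiteDimensional_fixedField_of_isOpen H hopen
  haveI hfd : FiniteDimensional ℚ L := hfd'
  have hL2' := (finrank_fixedField_of_isOpen H hopen).trans hind
  have hL2 : Module.finrank ℚ L = 2 := hL2'
  have hnormal : L.fixingSubgroup.Normal := by rw [hLH]; exact hHn
  haveI hGal' := (InfiniteGalois.normal_iff_isGalois L).mp hnormal
  haveI hGal : IsGalois ℚ L := hGal'
  haveI : NumberField L := NumberField.mk
  obtain ⟨P, hPmax, hP⟩ :=
    NumberField.exists_not_isUnramifiedAt_int (K := L) (𝒪 := 𝓞 L) (by rw [hL2]; decide)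
  apply hP
  -- a prime `𝔓` of `\bar ℤ` above `P`; it is maximal
  obtain ⟨𝔓, h𝔓prime, h𝔓P⟩ := exists_isPrime_comap_ringOfIntegersToIntegralClosure_eq L P
  subst h𝔓P
  haveI := h𝔓prime
  have h𝔓max : 𝔓.IsMaximal := by
    set φ : 𝓞 L →+* absIntegers (𝓞 ℚ) ℚ :=
      EllipticCurves.ringOfIntegersToIntegralClosure (k := ℚ) (Ω := AlgebraicClosure ℚ) L with hφ
    letI : Algebra (𝓞 L) (absIntegers (𝓞 ℚ) ℚ) := φ.toAlgebra
    haveI : IsScalarTower (𝓞 ℚ) (𝓞 L) (absIntegers (𝓞 ℚ) ℚ) :=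
      IsScalarTower.of_algebraMap_eq fun x ↦ rfl
    haveI : Algebra.IsIntegral (𝓞 L) (absIntegers (𝓞 ℚ) ℚ) :=
      ⟨fun x ↦ (Algebra.IsIntegral.isIntegral (R := 𝓞 ℚ) x).tower_top⟩
    refine Ideal.isMaximal_of_isIntegral_of_isMaximal_comap (R := 𝓞 L) 𝔓 ?_
    exact hPmax
  -- the inertia group of `P = 𝔓 ∩ 𝓞 L` in `Gal(L/ℚ)` is trivial: it is `I_𝔓|_L`, and `I_𝔓 ≤ H`
  -- fixes `L` pointwise
  have hbot : (𝔓.inertia (absoluteGaloisGroup ℚ)).map (absRestrictNormalHom L) = ⊥ := by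
    rw [eq_bot_iff]
    rintro _ ⟨σ, hσ, rfl⟩
    rw [Subgroup.mem_bot, absRestrictNormalHom_eq_one_iff]
    have hσH : σ ∈ H := hall 𝔓 h𝔓max hσ
    rw [← hLH] at hσH
    exact hσH
  have key :=
    (Literature.NumberTheory.NumberFields.inertia_comap_ringOfIntegers_eq_map_absRestrictNormalHom
      L 𝔓).trans hbot
  have hI : (𝔓.comap (EllipticCurves.ringOfIntegersToIntegralClosure (k := ℚ)
      (Ω := AlgebraicClosure ℚ) L)).inertia (L ≃ₐ[ℚ] L) = ⊥ := by
    exact key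
  -- `e(P) = #I(P) = 1`, i.e. `P` is unramified over `ℤ`
  set P := 𝔓.comap (EllipticCurves.ringOfIntegersToIntegralClosure (k := ℚ)
      (Ω := AlgebraicClosure ℚ) L) with hPdef
  haveI : (P.under ℤ).IsPrime := Ideal.IsPrime.under ℤ P
  have he := Ideal.card_inertia_eq_ramificationIdxIn (G := L ≃ₐ[ℚ] L) (P.under ℤ) P
  rw [hI, Subgroup.card_bot] at he
  rw [← Ideal.ramificationIdx_eq_one_iff,
    ← Ideal.ramificationIdxIn_eq_ramificationIdx (P.under ℤ) P (L ≃ₐ[ℚ] L), ← he]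


/-! ### §1 Transport: a reducible `E_K[p]` gives a `Gal(ℚ̄/K)`-stable line in `E[p]` -/

section Transport

variable (W : WeierstrassCurve ℚ) [W.IsElliptic] (K : Type) [Field K] [NumberField K]
  (p : ℕ) [Fact p.Prime]

/-- **If `E_K[p]` is reducible, `E[p] = E(ℚ̄)[p]` has a line stable under `Gal(ℚ̄/K) ≤ Γ_ℚ`**
(the image of the restriction `Γ_K → Γ_ℚ`): a `Γ_K`-stable subgroup `H' ≠ 0, E_K[p]` of
`E_K[p] = E_K(K̄)[p]` pulls back along the `res`-equivariant identification `E(ℚ̄) ≃ E_K(K̄)`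
(`exists_addEquiv_geomPoints_baseChange`) to a `res(Γ_K)`-stable subgroup of `E[p]` of order `p`
(`#E[p] = p²`). (Same transport as the Summits-side
`hasIrreducibleModPGaloisRep_baseChange_of_forall_stable`; "if `ρ` is irreducible but `ρ|_{G_K}`
is not …" in the printed proof.) [cite: MatarNekovar2019, proof of Prop. 5.26 (2) (p. 493)]
[cite: SilvermanAEC2009, Cor. III.6.4(b)] -/
theorem exists_line_of_not_hasIrreducibleModPGaloisRep_baseChange
    (hred : ¬ (W.baseChange K).HasIrreducibleModPGaloisRep p) :
    ∃ Φ : AddSubgroup (geomTorsion W (p : ℤ)), Nat.card Φ = p ∧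
      ∀ σ ∈ (absGaloisRestrict ℚ K).range, ∀ P ∈ Φ, σ • P ∈ Φ := by
  have hp : p.Prime := Fact.out
  obtain ⟨e, he⟩ := W.exists_addEquiv_geomPoints_baseChange K
  -- restriction of `e` to `p`-torsion, onto `E_K[p]`, equivariant along `res`
  have hmem : ∀ T : geomTorsion W (p : ℤ), e T ∈ geomTorsion (W.baseChange K) (p : ℤ) := by
    intro T
    rw [AddSubgroup.torsionBy.nsmul_iff, ← map_nsmul, AddSubgroup.torsionBy.nsmul_iff.mp T.2,
      map_zero]
  let φ : geomTorsion W (p : ℤ) →+ geomTorsion (W.baseChange K) (p : ℤ) :=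
    AddMonoidHom.codRestrict ((e : W.geomPoints →+ (W.baseChange K).geomPoints).comp
      (geomTorsion W (p : ℤ)).subtype) (geomTorsion (W.baseChange K) (p : ℤ)) hmem
  have hφ : ∀ T, ((φ T : geomTorsion (W.baseChange K) (p : ℤ)) : (W.baseChange K).geomPoints) =
      e T := fun T ↦ rfl
  have hφinj : Function.Injective φ := by
    intro T₁ T₂ h
    have h' := congrArg (fun x : geomTorsion (W.baseChange K) (p : ℤ) ↦
      (x : (W.baseChange K).geomPoints)) h
    simp only [hφ] at h'
    exact Subtype.ext (e.injective h')
  have hφsurj : Function.Surjective φ := by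
    intro S
    have hS : e.symm S ∈ geomTorsion W (p : ℤ) := by
      rw [AddSubgroup.torsionBy.nsmul_iff]
      apply e.injective
      rw [map_nsmul, AddEquiv.apply_symm_apply, map_zero]
      exact AddSubgroup.torsionBy.nsmul_iff.mp S.2
    refine ⟨⟨e.symm S, hS⟩, Subtype.ext ?_⟩
    rw [hφ]
    exact e.apply_symm_apply S
  have hφsmul : ∀ (γ : absoluteGaloisGroup K) (T : geomTorsion W (p : ℤ)),
      φ (absGaloisRestrict ℚ K γ • T) = γ • φ T := fun γ T ↦
    Subtype.ext (by
      rw [AddSubgroup.torsionBy.coe_smul, hφ, hφ, AddSubgroup.torsionBy.coe_smul]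
      exact he γ T)
  -- a `Γ_K`-stable `H' ≠ ⊥, ⊤` in `E_K[p]`
  unfold WeierstrassCurve.HasIrreducibleModPGaloisRep at hred
  simp only [not_forall, not_or] at hred
  obtain ⟨H', hH'stab, hH'bot, hH'top⟩ := hred
  refine ⟨H'.comap φ, ?_, ?_⟩
  · -- order `p`: not `⊥`, not `⊤`, inside a group of order `p²`
    have hE := Rank1Residual.natCard_geomTorsion W p
    haveI : Finite (geomTorsion W (p : ℤ)) :=
      Nat.finite_of_card_ne_zero (by rw [hE]; exact pow_ne_zero 2 hp.ne_zero)
    have hbot : H'.comap φ ≠ ⊥ := by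
      intro h
      apply hH'bot
      rw [eq_bot_iff]
      intro x hx
      obtain ⟨T, rfl⟩ := hφsurj x
      have hT : T ∈ H'.comap φ := by rw [AddSubgroup.mem_comap]; exact hx
      rw [h, AddSubgroup.mem_bot] at hT
      rw [hT, map_zero]
      exact AddSubgroup.zero_mem _
    have htop : H'.comap φ ≠ ⊤ := by
      intro h
      apply hH'top
      rw [eq_top_iff]
      intro x _
      obtain ⟨T, rfl⟩ := hφsurj x
      have hT : T ∈ H'.comap φ := by rw [h]; exact AddSubgroup.mem_top T
      exact AddSubgroup.mem_comap.mp hT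
    have hdvd : Nat.card (H'.comap φ) ∣ p ^ 2 := hE ▸ (H'.comap φ).card_addSubgroup_dvd_card
    obtain ⟨i, hi, hHi⟩ := (Nat.dvd_prime_pow hp).mp hdvd
    interval_cases i
    · exact absurd (AddSubgroup.card_eq_one.mp (by simpa using hHi)) hbot
    · simpa using hHi
    · exact absurd ((AddSubgroup.card_eq_iff_eq_top _).mp (by rw [hHi, hE])) htop
  · rintro σ ⟨γ, rfl⟩ T hT
    rw [AddSubgroup.mem_comap] at hT ⊢
    change φ (absGaloisRestrict ℚ K γ • T) ∈ H'
    rw [hφsmul]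
    exact hH'stab γ _ hT

end Transport

/-! ### §2 Stabilisers of lines: the subgroup `U` and its companion line -/

section Stabiliser

variable {W : WeierstrassCurve ℚ} {p : ℕ}

/-- For a finite subgroup `Φ ≤ E[p]`: `σ` stabilises `Φ` (as a set, `σ • Φ = Φ`) iff `σ` maps `Φ`
into itself. [folklore] -/
private theorem mem_stabilizer_iff_forall_smul_mem {Φ : AddSubgroup (geomTorsion W (p : ℤ))} [Finite Φ]
    (σ : absoluteGaloisGroup ℚ) :
    σ ∈ MulAction.stabilizer (absoluteGaloisGroup ℚ) Φ ↔ ∀ P ∈ Φ, σ • P ∈ Φ := by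
  rw [MulAction.mem_stabilizer_iff]
  constructor
  · intro h P hP
    rw [← h]
    exact AddSubgroup.smul_mem_pointwise_smul P σ Φ hP
  · intro h
    have hle : σ • Φ ≤ Φ := by
      intro x hx
      obtain ⟨P, hP, rfl⟩ := AddSubgroup.mem_smul_pointwise_iff_exists x σ Φ |>.mp hx
      exact h P hP
    have hcard : Nat.card Φ ≤ Nat.card (σ • Φ : AddSubgroup (geomTorsion W (p : ℤ))) := by
      rw [AddSubgroup.pointwise_smul_def, AddSubgroup.card_map_of_injective]
      intro x y hxy
      exact smul_left_cancel σ (by simpa using hxy)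
    exact AddSubgroup.eq_of_le_of_card_ge hle hcard

/-- `#(σ • Φ) = #Φ`. [folklore] -/
private theorem card_pointwise_smul (Φ : AddSubgroup (geomTorsion W (p : ℤ))) (σ : absoluteGaloisGroup ℚ) :
    Nat.card (σ • Φ : AddSubgroup (geomTorsion W (p : ℤ))) = Nat.card Φ := by
  rw [AddSubgroup.pointwise_smul_def, AddSubgroup.card_map_of_injective]
  intro x y hxy
  exact smul_left_cancel σ (by simpa using hxy)

end Stabiliser


/-! ### §2 (continued) The stabiliser of an `H`-stable line is `H`; the companion line -/

section Structure

variable {W : WeierstrassCurve ℚ} {p : ℕ} [Fact p.Prime]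
  {H : Subgroup (absoluteGaloisGroup ℚ)} {Φ₀ : AddSubgroup (geomTorsion W (p : ℤ))}

/-- A subgroup of prime order is finite. [folklore] -/
private theorem finite_of_card_eq (hΦ₀ : Nat.card Φ₀ = p) : Finite Φ₀ :=
  Nat.finite_of_card_ne_zero (by rw [hΦ₀]; exact (Fact.out : p.Prime).ne_zero)

/-- A line is not `0`. [folklore] -/
private theorem ne_bot_of_card_eq (hΦ₀ : Nat.card Φ₀ = p) : Φ₀ ≠ ⊥ := by
  intro h
  have := hΦ₀
  rw [h, AddSubgroup.card_bot] at this
  exact (Fact.out : p.Prime).one_lt.ne this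

/-- A line is not all of `E[p]` (`#E[p] = p²`). [cite: SilvermanAEC2009, Cor. III.6.4(b)] -/
theorem ne_top_of_card_eq [W.IsElliptic] (hΦ₀ : Nat.card Φ₀ = p) : Φ₀ ≠ ⊤ := by
  intro h
  have hp : p.Prime := Fact.out
  have := hΦ₀
  rw [h, AddSubgroup.card_top, Rank1Residual.natCard_geomTorsion W p, pow_two] at this
  exact absurd this (by nlinarith [hp.one_lt])

/-- **The stabiliser of an `H`-stable line is `H`** when `[Γ_ℚ : H] = 2` and `E[p]` is irreducible:
it contains `H`, so has index `1` or `2`, and index `1` would make the line `Γ_ℚ`-stable.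
[cite: MatarNekovar2019, proof of Prop. 5.26 (2) (p. 493), "`ρ(G_ℚ) ≠ ρ(G_K)`"] -/
theorem stabilizer_eq_of_index_two [W.IsElliptic] (hirr : W.HasIrreducibleModPGaloisRep p)
    (hH2 : H.index = 2) (hΦ₀ : Nat.card Φ₀ = p) (hstab : ∀ σ ∈ H, ∀ P ∈ Φ₀, σ • P ∈ Φ₀) :
    MulAction.stabilizer (absoluteGaloisGroup ℚ) Φ₀ = H := by
  haveI := finite_of_card_eq hΦ₀
  set U := MulAction.stabilizer (absoluteGaloisGroup ℚ) Φ₀ with hU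
  have hHU : H ≤ U := fun σ hσ ↦ (mem_stabilizer_iff_forall_smul_mem σ).mpr (hstab σ hσ)
  have hUtop : U ≠ ⊤ := by
    intro htop
    have hall : ∀ σ : absoluteGaloisGroup ℚ, ∀ P ∈ Φ₀, σ • P ∈ Φ₀ := fun σ ↦
      (mem_stabilizer_iff_forall_smul_mem σ).mp (by rw [← hU, htop]; exact Subgroup.mem_top σ)
    rcases hirr Φ₀ hall with h | h
    · exact ne_bot_of_card_eq hΦ₀ h
    · exact ne_top_of_card_eq hΦ₀ h
  have hidx : H.relIndex U * U.index = 2 := by rw [Subgroup.relIndex_mul_index hHU, hH2]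
  have hUi : U.index ≠ 1 := fun h ↦ hUtop (Subgroup.index_eq_one.mp h)
  have hrel : H.relIndex U = 1 := by
    have hdvd : U.index ∣ 2 := ⟨H.relIndex U, by rw [mul_comm]; exact hidx.symm⟩
    rcases (Nat.dvd_prime Nat.prime_two).mp hdvd with h1 | h2
    · exact absurd h1 hUi
    · rw [h2] at hidx; omega
  exact le_antisymm (Subgroup.relIndex_eq_one.mp hrel) hHU

variable (hH2 : H.index = 2) (hUH : MulAction.stabilizer (absoluteGaloisGroup ℚ) Φ₀ = H)
include hH2 hUH

omit [Fact p.Prime] hUH in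
/-- Every square lies in `H` (`[Γ_ℚ : H] = 2`). [folklore] -/
private theorem mul_self_mem_of_index_two (σ : absoluteGaloisGroup ℚ) : σ * σ ∈ H :=
  (Subgroup.mul_mem_iff_of_index_two hH2).mpr Iff.rfl

omit [Fact p.Prime] in
/-- Off `H`, every element moves `Φ₀` to the same line `g Φ₀`. [folklore] -/
private theorem smul_eq_smul_of_not_mem {g σ : absoluteGaloisGroup ℚ} (hg : g ∉ H) (hσ : σ ∉ H) :
    σ • Φ₀ = g • Φ₀ := by
  have h1 : g⁻¹ * σ ∈ H := by
    rw [Subgroup.mul_mem_iff_of_index_two hH2, Subgroup.inv_mem_iff]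
    exact ⟨fun h ↦ absurd h hg, fun h ↦ absurd h hσ⟩
  rw [← hUH, MulAction.mem_stabilizer_iff] at h1
  rw [show σ = g * (g⁻¹ * σ) by group, mul_smul, h1]

omit [Fact p.Prime] in
/-- `H` also stabilises the companion line `g Φ₀` (`H` is normal). [folklore] -/
private theorem smul_smul_eq_of_mem {g σ : absoluteGaloisGroup ℚ} (hσ : σ ∈ H) :
    σ • g • Φ₀ = g • Φ₀ := by
  haveI : H.Normal := Subgroup.normal_of_index_eq_two hH2
  have h1 : g⁻¹ * σ * g ∈ H := by
    have := Subgroup.Normal.conj_mem inferInstance σ hσ g⁻¹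
    rwa [inv_inv] at this
  rw [← hUH, MulAction.mem_stabilizer_iff] at h1
  rw [smul_smul, show σ * g = g * (g⁻¹ * σ * g) by group, mul_smul, h1]

omit [Fact p.Prime] in
/-- Off `H`, every element moves `g Φ₀` back to `Φ₀`. [folklore] -/
private theorem smul_smul_eq_of_not_mem {g σ : absoluteGaloisGroup ℚ} (hg : g ∉ H) (hσ : σ ∉ H) :
    σ • g • Φ₀ = Φ₀ := by
  have h1 : σ * g ∈ H := by
    rw [Subgroup.mul_mem_iff_of_index_two hH2]
    exact ⟨fun h ↦ absurd h hσ, fun h ↦ absurd h hg⟩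
  rw [← hUH, MulAction.mem_stabilizer_iff] at h1
  rw [smul_smul, h1]

omit [Fact p.Prime] hH2 in
/-- `g ∉ H` moves `Φ₀`. [folklore] -/
private theorem smul_ne_of_not_mem {g : absoluteGaloisGroup ℚ} (hg : g ∉ H) : g • Φ₀ ≠ Φ₀ := by
  intro h
  apply hg
  rw [← hUH, MulAction.mem_stabilizer_iff]
  exact h

omit hH2 in
/-- An element mapping `Φ₀` into itself lies in `H`. [folklore] -/
private theorem mem_of_forall_smul_mem (hΦ₀ : Nat.card Φ₀ = p) {σ : absoluteGaloisGroup ℚ}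
    (h : ∀ P ∈ Φ₀, σ • P ∈ Φ₀) : σ ∈ H := by
  haveI := finite_of_card_eq hΦ₀
  rw [← hUH]
  exact (mem_stabilizer_iff_forall_smul_mem σ).mpr h

/-- An element mapping the companion line `g Φ₀` into itself lies in `H`. [folklore] -/
private theorem mem_of_forall_smul_mem_smul (hΦ₀ : Nat.card Φ₀ = p) {g σ : absoluteGaloisGroup ℚ}
    (hg : g ∉ H) (h : ∀ P ∈ g • Φ₀, σ • P ∈ g • Φ₀) : σ ∈ H := by
  haveI := finite_of_card_eq hΦ₀
  haveI : Finite (g • Φ₀ : AddSubgroup (geomTorsion W (p : ℤ))) :=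
    Nat.finite_of_card_ne_zero (by
      rw [card_pointwise_smul, hΦ₀]; exact (Fact.out : p.Prime).ne_zero)
  by_contra hσ
  have h1 : σ • g • Φ₀ = g • Φ₀ :=
    (MulAction.mem_stabilizer_iff).mp ((mem_stabilizer_iff_forall_smul_mem σ).mpr h)
  have h2 := smul_smul_eq_of_not_mem hH2 hUH hg hσ
  exact smul_ne_of_not_mem hUH hg (h1.symm.trans h2)

omit hH2 hUH in
/-- Two distinct lines meet in `0`. [folklore] -/
private theorem inf_eq_bot_of_ne (hΦ₀ : Nat.card Φ₀ = p) {Φ₁ : AddSubgroup (geomTorsion W (p : ℤ))}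
    (hΦ₁ : Nat.card Φ₁ = p) (hne : Φ₁ ≠ Φ₀) : Φ₀ ⊓ Φ₁ = ⊥ := by
  rw [eq_bot_iff]
  intro x hx
  rw [AddSubgroup.mem_bot]
  by_contra hx0
  obtain ⟨hx₀, hx₁⟩ := AddSubgroup.mem_inf.mp hx
  exact hne ((eq_zmultiples_of_card_eq_prime hΦ₁ hx₁ hx0).trans
    (eq_zmultiples_of_card_eq_prime hΦ₀ hx₀ hx0).symm)

omit hH2 hUH in
/-- Two distinct lines span `E[p]` (`#E[p] = p²`). [cite: SilvermanAEC2009, Cor. III.6.4(b)] -/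
theorem sup_eq_top_of_ne [W.IsElliptic] (hΦ₀ : Nat.card Φ₀ = p)
    {Φ₁ : AddSubgroup (geomTorsion W (p : ℤ))} (hΦ₁ : Nat.card Φ₁ = p) (hne : Φ₁ ≠ Φ₀) :
    Φ₀ ⊔ Φ₁ = ⊤ := by
  have hp : p.Prime := Fact.out
  have hE := Rank1Residual.natCard_geomTorsion W p
  haveI : Finite (geomTorsion W (p : ℤ)) :=
    Nat.finite_of_card_ne_zero (by rw [hE]; exact pow_ne_zero 2 hp.ne_zero)
  have hdvd : Nat.card (Φ₀ ⊔ Φ₁ : AddSubgroup (geomTorsion W (p : ℤ))) ∣ p ^ 2 := by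
    rw [← hE]; exact (Φ₀ ⊔ Φ₁).card_addSubgroup_dvd_card
  obtain ⟨i, hi, hcard⟩ := (Nat.dvd_prime_pow hp).mp hdvd
  have hpd : Nat.card Φ₀ ∣ Nat.card (Φ₀ ⊔ Φ₁ : AddSubgroup (geomTorsion W (p : ℤ))) :=
    AddSubgroup.card_dvd_of_le le_sup_left
  rw [hΦ₀, hcard] at hpd
  have hi0 : i ≠ 0 := by
    rintro rfl
    rw [pow_zero, Nat.dvd_one] at hpd
    exact hp.one_lt.ne' hpd
  have hi1 : i ≠ 1 := by
    rintro rfl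
    rw [pow_one] at hcard
    -- `Φ₀ = Φ₀ ⊔ Φ₁ ≥ Φ₁`, so `Φ₁ = Φ₀`
    have h0 : Φ₀ = Φ₀ ⊔ Φ₁ :=
      AddSubgroup.eq_of_le_of_card_ge le_sup_left (by rw [hcard, hΦ₀])
    have h1 : Φ₁ ≤ Φ₀ := by rw [h0]; exact le_sup_right
    haveI := finite_of_card_eq hΦ₀
    exact hne (AddSubgroup.eq_of_le_of_card_ge h1 (by rw [hΦ₀, hΦ₁]))
  have hi2 : i = 2 := by omega
  subst hi2
  exact (AddSubgroup.card_eq_iff_eq_top _).mp (hcard.trans hE.symm)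

end Structure


/-! ### §3 The ramification of `H = Gal(ℚ̄/K)` away from `p` -/

section Away

variable {W : WeierstrassCurve ℚ} [W.IsElliptic] {p : ℕ} [Fact p.Prime]
  {H : Subgroup (absoluteGaloisGroup ℚ)} {Φ₀ : AddSubgroup (geomTorsion W (p : ℤ))}
  (hUH : MulAction.stabilizer (absoluteGaloisGroup ℚ) Φ₀ = H) (hΦ₀ : Nat.card Φ₀ = p)
include hUH hΦ₀

/-- **Lemme 2 at a good prime `q ≠ p`** (Néron–Ogg–Shafarevich, Silverman VII.4.1): the inertia
group of every prime of `\bar ℤ` above a prime `q ≠ p` of good reduction acts trivially on `E[p]`,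
hence stabilises `Φ₀`, hence lies in `H`. [cite: Serre1972, §4.2 Lemme 2]
[cite: SilvermanAEC2009, Prop. VII.4.1(a)] -/
theorem inertia_le_of_good [W.IsGloballyMinimal] {q : ℕ} [Fact q.Prime] (hqp : q ≠ p)
    (hgood : W.HasGoodReductionAtPrime q) {v : HeightOneSpectrum (𝓞 ℚ)}
    (hv : (primesEquiv v : ℕ) = q) {𝔔 : Ideal (absIntegers (𝓞 ℚ) ℚ)} (h𝔔 : 𝔔 ∈ v.primesAbove) :
    𝔔.inertia (absoluteGaloisGroup ℚ) ≤ H := by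
  intro τ hτ
  refine mem_of_forall_smul_mem hUH hΦ₀ fun P hP ↦ ?_
  have h1 := W.galoisRepTorsion_eq_one_of_mem_inertia_prime p hqp hgood hv h𝔔 hτ
  rw [(galoisRepTorsion_eq_one_iff' W (p : ℤ) τ).mp h1 P]
  exact hP

end Away

/-- `n ∈ v ↔ q_v ∣ n` for a natural number `n` and a finite place `v` of `ℚ` over the prime
`q_v = primesEquiv v`. [folklore] -/
private theorem natCast_mem_asIdeal_iff_primesEquiv_dvd (v : HeightOneSpectrum (𝓞 ℚ)) (n : ℕ) :
    (n : 𝓞 ℚ) ∈ v.asIdeal ↔ (primesEquiv v : ℕ) ∣ n := by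
  rw [show ((primesEquiv v : Nat.Primes) : ℕ) = natGenerator v from rfl, natGenerator_dvd_iff,
    ← map_natCast (Rat.IsIntegralClosure.intEquiv (𝓞 ℚ)) n, Ideal.apply_mem_of_equiv_iff]

/-- `q_v ∈ 𝔔` for a prime `𝔔` of `\bar ℤ` above the place `v`. [folklore] -/
private theorem natCast_primesEquiv_mem_of_mem_primesAbove {v : HeightOneSpectrum (𝓞 ℚ)}
    {𝔔 : Ideal (absIntegers (𝓞 ℚ) ℚ)} (h𝔔 : 𝔔 ∈ v.primesAbove) :
    ((primesEquiv v : ℕ) : absIntegers (𝓞 ℚ) ℚ) ∈ 𝔔 := by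
  have h1 : ((primesEquiv v : ℕ) : 𝓞 ℚ) ∈ v.asIdeal :=
    (natCast_mem_asIdeal_iff_primesEquiv_dvd v _).mpr dvd_rfl
  rw [h𝔔.2.over, Ideal.mem_comap, map_natCast] at h1
  exact h1

/-- **A prime `q ∣ N_E` is unramified in `K` when `(N_E, d_K) = 1`**, so its inertia groups lie in
`H = Gal(ℚ̄/K)` (Dedekind: `q ∤ d_K ⇒ e_q(K) = 1`, Mathlib `NumberField.not_dvd_discr_iff_forall_mem`;
then `I_𝔔 ≤ Gal(ℚ̄/K)`, tree `inertia_le_range_absGaloisRestrict`).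
[cite: MatarNekovar2019, proof of Prop. 5.26 (2) (p. 493), "`D_K = p*`"]
[cite: NeukirchANT1999, Ch. III §2, Cor. (2.12)] -/
theorem inertia_le_range_of_dvd_conductorNorm (W : WeierstrassCurve ℚ) (K : Type) [Field K]
    [NumberField K] (h2 : Module.finrank ℚ K = 2)
    (hcop : Nat.Coprime (W.conductorNorm ℤ) (NumberField.discr K).natAbs)
    {v : HeightOneSpectrum (𝓞 ℚ)} (hdvd : (primesEquiv v : ℕ) ∣ W.conductorNorm ℤ)
    {𝔔 : Ideal (absIntegers (𝓞 ℚ) ℚ)} (h𝔔 : 𝔔 ∈ v.primesAbove) :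
    𝔔.inertia (absoluteGaloisGroup ℚ) ≤ (absGaloisRestrict ℚ K).range := by
  haveI : Algebra.IsQuadraticExtension ℚ K := { finrank_eq_two' := h2 }
  have hnd : ¬ (primesEquiv v : ℕ) ∣ (NumberField.discr K).natAbs := fun h ↦
    (primesEquiv v).2.one_lt.ne' (Nat.eq_one_of_dvd_one
      ((Nat.Coprime.coprime_dvd_left hdvd hcop) ▸ Nat.dvd_gcd dvd_rfl h))
  exact inertia_le_range_absGaloisRestrict ℚ K
    (ModularForms.ramificationIdxIn_eq_one_of_not_dvd_natAbs_discr K v hnd) h𝔔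

/-! ### §4 Serre's Proposition 12: no `H`-stable line at a good supersingular `p` -/

section AtP

variable {W : WeierstrassCurve ℚ} [W.IsElliptic] [W.IsGloballyMinimal] {p : ℕ} [Fact p.Prime]
  {H : Subgroup (absoluteGaloisGroup ℚ)} {Φ₀ : AddSubgroup (geomTorsion W (p : ℤ))}
  (hH2 : H.index = 2) (hUH : MulAction.stabilizer (absoluteGaloisGroup ℚ) Φ₀ = H)
  (hΦ₀ : Nat.card Φ₀ = p)
include hH2 hUH hΦ₀

/-- **Supersingular `p` is impossible** (Serre 1972 §1.11 Prop. 12; "`ρ(G_{ℚ_p}) = N(C_ns)` …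
impossible" in the printed proof): at an odd prime `p` of good supersingular reduction the inertia
image is cyclic of order `p² − 1` (`isCyclic_and_card_inertia_map_of_dvd_frobeniusTrace`); the
SQUARE `σ` of a generator lies in `H`, so stabilises the line `Φ₀` and acts on `Φ₀` and
`E[p]/Φ₀` by scalars; then `σ^{p−1}` is unipotent and `σ^{p(p−1)} = 1` on `E[p]`, forcing
`p² − 1 ∣ 2p(p − 1)` — absurd. (Argument of the tree's
`hasIrreducibleModPGaloisRep_of_dvd_frobeniusTrace`, with `τ²` for `τ`.)
[cite: Serre1972, §1.11 Prop. 12] [cite: MatarNekovar2019, proof of Prop. 5.26 (2) (p. 493)] -/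
theorem false_of_supersingular (hp2 : p ≠ 2) (hgood : W.HasGoodReductionAtPrime p)
    (hss : (p : ℤ) ∣ W.frobeniusTrace p) : False := by
  have hp : p.Prime := Fact.out
  have hΔ : ¬ (p : ℤ) ∣ minimalDiscriminantInt W :=
    W.not_dvd_minimalDiscriminantInt_of_hasGoodReductionAtPrime' p hgood
  have hE := Rank1Residual.natCard_geomTorsion W p
  haveI : Finite (geomTorsion W (p : ℤ)) :=
    Nat.finite_of_card_ne_zero (by rw [hE]; exact pow_ne_zero 2 hp.ne_zero)
  haveI := finite_of_card_eq hΦ₀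
  -- the place, its prime, and a generator `τ` of the cyclic inertia image of order `p² − 1`
  set v : HeightOneSpectrum (𝓞 ℚ) := primesEquiv.symm ⟨p, hp⟩ with hvdef
  have hv : (primesEquiv v : ℕ) = p := by rw [hvdef, Equiv.apply_symm_apply]
  obtain ⟨𝔓, hmem, h𝔓⟩ := exists_ideal_placeOver p hv
  have hT : ∀ π ζ : AlgebraicClosure ℚ, π ^ (p ^ 2 - 1) = p → ζ ^ (p ^ 2 - 1) = 1 →
      ∃ s ∈ 𝔓.inertia (absoluteGaloisGroup ℚ), s • π = ζ * π := fun π ζ hπ hζ ↦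
    exists_mem_inertia_smul_eq_mul_of_pow_eq p
      (Nat.sub_pos_of_lt (Nat.one_lt_pow two_ne_zero hp.one_lt)) hv h𝔓 hπ hζ
  obtain ⟨hcyc, hcard⟩ := isCyclic_and_card_inertia_map_of_dvd_frobeniusTrace p hΔ hss hp2 hmem hT
  set G := (𝔓.inertia (absoluteGaloisGroup ℚ)).map (galoisRepTorsion W (p : ℤ)) with hGdef
  haveI := hcyc
  obtain ⟨gen, hgen⟩ := IsCyclic.exists_ofOrder_eq_natCard (α := G)
  obtain ⟨τ, -, hτg⟩ := Subgroup.mem_map.mp gen.2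
  have hordτ : orderOf (galoisRepTorsion W (p : ℤ) τ) = p ^ 2 - 1 := by
    rw [hτg, Subgroup.orderOf_coe, hgen, hcard]
  -- `σ = τ²` lies in `H` (index two) and stabilises `Φ₀`
  set σ : absoluteGaloisGroup ℚ := τ * τ with hσdef
  have hσH : σ ∈ H := mul_self_mem_of_index_two hH2 τ
  have hstab : ∀ P ∈ Φ₀, σ • P ∈ Φ₀ :=
    (mem_stabilizer_iff_forall_smul_mem σ).mp (by rw [hUH]; exact hσH)
  obtain ⟨k, hk⟩ := exists_smul_eq_zsmul_of_stable hΦ₀ hstab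
  obtain ⟨d, hd⟩ := exists_smul_sub_zsmul_mem_of_stable hΦ₀ hE hstab
  -- `k` and `d` are prime to `p`
  have hnt : 1 < Nat.card Φ₀ := by rw [hΦ₀]; exact hp.one_lt
  haveI : Nontrivial Φ₀ := Finite.one_lt_card_iff_nontrivial.mp hnt
  obtain ⟨⟨P₀, hP₀⟩, hP₀0⟩ := exists_ne (0 : Φ₀)
  have hP₀0' : P₀ ≠ 0 := fun h ↦ hP₀0 (Subtype.ext h)
  have hptor : ∀ P : geomTorsion W (p : ℤ), ((p : ℕ) : ℤ) • P = 0 := fun P ↦ by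
    rw [← Subtype.coe_inj, AddSubgroupClass.coe_zsmul, ZeroMemClass.coe_zero]
    exact (Submodule.mem_torsionBy_iff _ _).mp P.2
  have hkp : ¬ (p : ℤ) ∣ k := by
    rintro ⟨c, rfl⟩
    have h := hk P₀ hP₀
    rw [mul_zsmul, hptor] at h
    exact hP₀0' ((smul_eq_zero_iff_eq σ).mp h)
  have hdp : ¬ (p : ℤ) ∣ d := by
    rintro ⟨c, rfl⟩
    have hall : ∀ P : geomTorsion W (p : ℤ), σ • P ∈ Φ₀ := fun P ↦ by
      have h := hd P
      rwa [mul_zsmul, hptor, sub_zero] at h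
    have htop : Φ₀ = ⊤ := by
      refine eq_top_iff.mpr fun P _ ↦ ?_
      have := hall (σ⁻¹ • P)
      rwa [smul_inv_smul] at this
    exact ne_top_of_card_eq hΦ₀ htop
  -- Fermat
  have hpi : Prime (p : ℤ) := Nat.prime_iff_prime_int.mp hp
  have hfermat : ∀ m : ℤ, ¬ (p : ℤ) ∣ m → ∀ P : geomTorsion W (p : ℤ), (m ^ (p - 1)) • P = P := by
    intro m hm P
    have h1 : m ^ (p - 1) ≡ 1 [ZMOD p] :=
      Int.ModEq.pow_card_sub_one_eq_one hp ((hpi.coprime_iff_not_dvd.mpr hm).symm)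
    obtain ⟨c, hc⟩ := (Int.modEq_iff_dvd.mp h1.symm)
    have h2' : m ^ (p - 1) = 1 + (p : ℤ) * c := by linarith
    rw [h2', add_smul, one_smul, mul_zsmul, hptor, add_zero]
  -- `σ^{p-1}` is unipotent, so `σ^{(p-1)p}` is trivial on `E[p]`
  have hfix : ∀ P ∈ Φ₀, (σ ^ (p - 1)) • P = P := fun P hP ↦ by
    rw [pow_smul_eq_pow_zsmul hk (p - 1) P hP, hfermat k hkp P]
  have hquot : ∀ P : geomTorsion W (p : ℤ), (σ ^ (p - 1)) • P - P ∈ Φ₀ := fun P ↦ by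
    have h := pow_smul_sub_pow_zsmul_mem hstab hd (p - 1) P
    rwa [hfermat d hdp P] at h
  have htriv : ∀ P : geomTorsion W (p : ℤ), (σ ^ ((p - 1) * p)) • P = P := fun P ↦ by
    rw [pow_mul]; exact pow_prime_smul_eq_self_of_unipotent hfix hquot P
  have hone : galoisRepTorsion W (p : ℤ) (σ ^ ((p - 1) * p)) = 1 :=
    (galoisRepTorsion_eq_one_iff' W (p : ℤ) _).mpr htriv
  rw [hσdef, ← pow_two, ← pow_mul, map_pow] at hone
  have hdvd : p ^ 2 - 1 ∣ 2 * ((p - 1) * p) := hordτ ▸ orderOf_dvd_of_pow_eq_one hone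
  -- `p² − 1 ∣ 2p(p − 1)` is absurd for a prime `p`
  obtain ⟨q, hq⟩ := hdvd
  have h1p : 1 ≤ p := hp.one_lt.le
  have h1p2 : 1 ≤ p ^ 2 := Nat.one_le_pow 2 p hp.pos
  have hqZ : (2 : ℤ) * (((p : ℤ) - 1) * p) = ((p : ℤ) ^ 2 - 1) * q := by
    have h := congrArg (Nat.cast : ℕ → ℤ) hq
    push_cast [Nat.cast_sub h1p, Nat.cast_sub h1p2] at h
    exact h
  have hp2Z : (2 : ℤ) ≤ p := by exact_mod_cast hp.two_le
  have hsq : (0 : ℤ) ≤ (p : ℤ) ^ 2 - 1 := by nlinarith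
  rcases Nat.lt_or_ge q 2 with hq2 | hq2
  · interval_cases q
    · simp only [Nat.cast_zero, mul_zero] at hqZ
      nlinarith
    · simp only [Nat.cast_one, mul_one] at hqZ
      nlinarith
  · have hq2Z : (2 : ℤ) ≤ q := by exact_mod_cast hq2
    nlinarith [mul_nonneg (sub_nonneg.mpr hq2Z) hsq]

end AtP


/-! ### §5 Serre's Proposition 11: at a good ordinary `p ≥ 5` the inertia groups lie in `H` -/

section Ordinary

variable {W : WeierstrassCurve ℚ} [W.IsElliptic] [W.IsGloballyMinimal] {p : ℕ} [Fact p.Prime]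

/-- **The ordinary line, `ℤ`-scalar form** (Serre 1972 §1.11 Prop. 11 and Cor.; tree
`exists_line_of_not_dvd_frobeniusTrace_of_mem_primesAbove`, `exists_mem_inertia_smul_eq_of_sub_mem_line`):
at a prime `𝔓 ∣ p` of `\bar ℤ`, `p` good ordinary, there is `v₀ ≠ 0` in `E[p]` with
`τ x − x ∈ ℤ v₀` for all `τ ∈ I_𝔓`, `x ∈ E[p]`, and for every `a` prime to `p` some `τ ∈ I_𝔓` with
`τ v₀ = a v₀` (`χ_X = χ̄_p` is onto on inertia). [cite: Serre1972, §1.11 Prop. 11 and Cor.] -/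
theorem exists_ordinaryLine (hgood : W.HasGoodReductionAtPrime p)
    (hord : ¬ (p : ℤ) ∣ W.frobeniusTrace p) {v : HeightOneSpectrum (𝓞 ℚ)}
    (hv : (primesEquiv v : ℕ) = p) {𝔓 : Ideal (absIntegers (𝓞 ℚ) ℚ)} (h𝔓 : 𝔓 ∈ v.primesAbove) :
    ∃ v₀ : geomTorsion W (p : ℤ), v₀ ≠ 0 ∧
      (∀ τ ∈ 𝔓.inertia (absoluteGaloisGroup ℚ), ∀ x : geomTorsion W (p : ℤ),
        ∃ n : ℤ, τ • x - x = n • v₀) ∧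
      (∀ a : ℤ, ¬ (p : ℤ) ∣ a →
        ∃ τ ∈ 𝔓.inertia (absoluteGaloisGroup ℚ), τ • v₀ = a • v₀) := by
  letI : Module (ZMod p) (geomTorsion W (p : ℤ)) := AddSubgroup.torsionBy.zmodModule
  have hp : p.Prime := Fact.out
  haveI : NeZero p := ⟨hp.ne_zero⟩
  have hΔ : ¬ (p : ℤ) ∣ minimalDiscriminantInt W :=
    W.not_dvd_minimalDiscriminantInt_of_hasGoodReductionAtPrime' p hgood
  obtain ⟨v₀, hv₀, hline⟩ := exists_line_of_not_dvd_frobeniusTrace_of_mem_primesAbove p hΔ hord hv h𝔓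
  have hzmod : ∀ (b : ZMod p) (x : geomTorsion W (p : ℤ)), b • x = ((b.val : ℕ) : ℤ) • x := by
    intro b x
    rw [natCast_zsmul, ← Nat.cast_smul_eq_nsmul (ZMod p), ZMod.natCast_zmod_val]
  refine ⟨v₀, hv₀, fun τ hτ x ↦ ?_, fun a ha ↦ ?_⟩
  · obtain ⟨b, hb⟩ := hline τ hτ x
    exact ⟨((b.val : ℕ) : ℤ), by rw [hb, hzmod]⟩
  · have hne : ((a : ℤ) : ZMod p) ≠ 0 := by
      rwa [Ne, ZMod.intCast_zmod_eq_zero_iff_dvd]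
    obtain ⟨τ, hτ, hτa⟩ :=
      W.exists_mem_inertia_smul_eq_of_sub_mem_line p hv h𝔓 hv₀ hline (Units.mk0 _ hne)
    refine ⟨τ, hτ, ?_⟩
    rw [hτa, Units.val_mk0, Int.cast_smul_eq_zsmul]

variable {H : Subgroup (absoluteGaloisGroup ℚ)} {Φ₀ : AddSubgroup (geomTorsion W (p : ℤ))}
  (hH2 : H.index = 2) (hUH : MulAction.stabilizer (absoluteGaloisGroup ℚ) Φ₀ = H)
  (hΦ₀ : Nat.card Φ₀ = p)
include hH2 hUH hΦ₀

omit [W.IsElliptic] [W.IsGloballyMinimal] hH2 hUH hΦ₀ in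
/-- A line of `E[p]` stable under `σ` on which `σ − 1` is invertible lies inside any subgroup
containing all the `σ x − x`: if `σ` acts on the line `Φ` by the scalar `k` with `p ∤ k − 1` and
`σ x − x ∈ X` for all `x`, then `Φ ≤ X`. [folklore] -/
private theorem le_of_scalar_ne_one {Φ X : AddSubgroup (geomTorsion W (p : ℤ))}
    {σ : absoluteGaloisGroup ℚ} {k : ℤ} (hk : ∀ P ∈ Φ, σ • P = k • P) (hk1 : ¬ (p : ℤ) ∣ k - 1)
    (hX : ∀ x : geomTorsion W (p : ℤ), σ • x - x ∈ X) : Φ ≤ X := by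
  have hp : p.Prime := Fact.out
  have hpi : Prime (p : ℤ) := Nat.prime_iff_prime_int.mp hp
  have hptor : ∀ P : geomTorsion W (p : ℤ), ((p : ℕ) : ℤ) • P = 0 := fun P ↦ by
    rw [← Subtype.coe_inj, AddSubgroupClass.coe_zsmul, ZeroMemClass.coe_zero]
    exact (Submodule.mem_torsionBy_iff _ _).mp P.2
  intro P hP
  obtain ⟨a, b, hab⟩ := (hpi.coprime_iff_not_dvd.mpr hk1).symm
  -- `P = a (k - 1) P + b p P = a (σ P - P)`
  have h1 : σ • P - P = (k - 1) • P := by rw [hk P hP, sub_smul, one_smul]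
  have h2 : P = a • (σ • P - P) := by
    rw [h1, smul_smul]
    have : (a * (k - 1)) • P = (1 - b * (p : ℤ)) • P := by
      rw [show a * (k - 1) = 1 - b * (p : ℤ) by linarith]
    rw [this, sub_smul, one_smul, mul_zsmul, hptor, smul_zero, sub_zero]
  rw [h2]
  exact X.zsmul_mem (hX P) a

/-- **Lemme 2 at `p` itself, ordinary case, `p ≥ 5`** (Serre 1972 §1.11 Prop. 11 with Cor.;
"`χ²_{p,ℚ_p}(I_p) = 1` forces `p = 3`" in the printed proof): at a prime `𝔓 ∣ p` of good
ordinary reduction, `p ≥ 5`, the inertia group `I_𝔓` lies in `H`. With `v₀, X = ℤ v₀` the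
ordinary line and `τ ∈ I_𝔓` acting on `v₀` by `2`, the square `σ = τ² ∈ H` stabilises `Φ₀` and
`g Φ₀` and acts there by scalars `k₀, k₁`; if `k_i ≢ 1` then `Φ_i ≤ X` (all `σ x − x ∈ X`), so
`Φ_i = X`; if `k₀ ≡ k₁ ≡ 1` then `σ` fixes `Φ₀ + g Φ₀ = E[p]` pointwise, yet `σ v₀ = 4 v₀ ≠ v₀`
(`p ∤ 3`). So `X ∈ {Φ₀, g Φ₀}`, and `I_𝔓`, which stabilises `X`, lies in `H`.
[cite: Serre1972, §1.11 Prop. 11 and Cor.] [cite: MatarNekovar2019, proof of Prop. 5.26 (2) (p. 493)] -/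
theorem inertia_le_of_ordinary (hp5 : 5 ≤ p) (hgood : W.HasGoodReductionAtPrime p)
    (hord : ¬ (p : ℤ) ∣ W.frobeniusTrace p) {v : HeightOneSpectrum (𝓞 ℚ)}
    (hv : (primesEquiv v : ℕ) = p) {𝔓 : Ideal (absIntegers (𝓞 ℚ) ℚ)} (h𝔓 : 𝔓 ∈ v.primesAbove)
    {g : absoluteGaloisGroup ℚ} (hg : g ∉ H) :
    𝔓.inertia (absoluteGaloisGroup ℚ) ≤ H := by
  have hp : p.Prime := Fact.out
  have hpi : Prime (p : ℤ) := Nat.prime_iff_prime_int.mp hp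
  haveI := finite_of_card_eq hΦ₀
  have hptor : ∀ P : geomTorsion W (p : ℤ), ((p : ℕ) : ℤ) • P = 0 := fun P ↦ by
    rw [← Subtype.coe_inj, AddSubgroupClass.coe_zsmul, ZeroMemClass.coe_zero]
    exact (Submodule.mem_torsionBy_iff _ _).mp P.2
  have hsmulz : ∀ (σ : absoluteGaloisGroup ℚ) (n : ℤ) (x : geomTorsion W (p : ℤ)),
      σ • (n • x) = n • (σ • x) := fun σ n x ↦ map_zsmul (DistribSMul.toAddMonoidHom _ σ) n x
  obtain ⟨v₀, hv₀, hline, hchar⟩ := exists_ordinaryLine hgood hord hv h𝔓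
  -- the line `X = ℤ v₀`, of order `p`, stable under `I_𝔓`
  set X : AddSubgroup (geomTorsion W (p : ℤ)) := AddSubgroup.zmultiples v₀ with hXdef
  have hordv₀ : addOrderOf v₀ = p := addOrderOf_eq_prime (by rw [← natCast_zsmul, hptor]) hv₀
  have hX : Nat.card X = p := by rw [hXdef, Nat.card_zmultiples, hordv₀]
  have hXstab : ∀ τ ∈ 𝔓.inertia (absoluteGaloisGroup ℚ), ∀ P ∈ X, τ • P ∈ X := by
    intro τ hτ P hP
    obtain ⟨m, rfl⟩ := AddSubgroup.mem_zmultiples_iff.mp hP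
    obtain ⟨n, hn⟩ := hline τ hτ v₀
    have hτv₀ : τ • v₀ = (n + 1) • v₀ := by
      rw [add_smul, one_smul, ← hn, sub_add_cancel]
    rw [hsmulz, hτv₀, smul_smul]
    exact AddSubgroup.zsmul_mem _ (AddSubgroup.mem_zmultiples v₀) _
  -- the companion line
  set Φ₁ : AddSubgroup (geomTorsion W (p : ℤ)) := g • Φ₀ with hΦ₁def
  have hΦ₁ : Nat.card Φ₁ = p := by rw [hΦ₁def, card_pointwise_smul, hΦ₀]
  have hne : Φ₁ ≠ Φ₀ := smul_ne_of_not_mem hUH hg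
  -- `τ ∈ I_𝔓` with `τ v₀ = 2 v₀`, `σ = τ²`
  have h2p : ¬ (p : ℤ) ∣ 2 := fun h ↦ by
    have := Int.le_of_dvd two_pos h
    omega
  obtain ⟨τ, hτ, hτ2⟩ := hchar 2 h2p
  set σ : absoluteGaloisGroup ℚ := τ * τ with hσdef
  have hσH : σ ∈ H := mul_self_mem_of_index_two hH2 τ
  have hσv₀ : σ • v₀ = (4 : ℤ) • v₀ := by
    rw [hσdef, mul_smul, hτ2, hsmulz, hτ2, smul_smul]; norm_num
  have hσsub : ∀ x : geomTorsion W (p : ℤ), σ • x - x ∈ X := by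
    intro x
    obtain ⟨n, hn⟩ := hline τ hτ x
    have hτx : τ • x = x + n • v₀ := by rw [← hn, add_sub_cancel]
    have : σ • x - x = (n + n * 2) • v₀ := by
      rw [hσdef, mul_smul, hτx, smul_add, hτx, hsmulz, hτ2, smul_smul, add_smul]
      abel
    rw [this]
    exact AddSubgroup.zsmul_mem _ (AddSubgroup.mem_zmultiples v₀) _
  have hstab₀ : ∀ P ∈ Φ₀, σ • P ∈ Φ₀ :=
    (mem_stabilizer_iff_forall_smul_mem σ).mp (by rw [hUH]; exact hσH)
  haveI : Finite Φ₁ := finite_of_card_eq hΦ₁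
  have hstab₁ : ∀ P ∈ Φ₁, σ • P ∈ Φ₁ :=
    (mem_stabilizer_iff_forall_smul_mem σ).mp
      ((MulAction.mem_stabilizer_iff).mpr (smul_smul_eq_of_mem hH2 hUH hσH))
  obtain ⟨k₀, hk₀⟩ := exists_smul_eq_zsmul_of_stable hΦ₀ hstab₀
  obtain ⟨k₁, hk₁⟩ := exists_smul_eq_zsmul_of_stable hΦ₁ hstab₁
  -- `X` is `Φ₀` or `Φ₁`
  have hXΦ : X = Φ₀ ∨ X = Φ₁ := by
    by_cases h₀ : (p : ℤ) ∣ k₀ - 1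
    · by_cases h₁ : (p : ℤ) ∣ k₁ - 1
      · -- `σ` fixes `Φ₀ ⊔ Φ₁ = E[p]` pointwise, but moves `v₀`
        exfalso
        have hfix : ∀ (Φ : AddSubgroup (geomTorsion W (p : ℤ))) (k : ℤ),
            (∀ P ∈ Φ, σ • P = k • P) → (p : ℤ) ∣ k - 1 → ∀ P ∈ Φ, σ • P = P := by
          intro Φ k hk hk1 P hP
          obtain ⟨c, hc⟩ := hk1
          rw [hk P hP, show k = 1 + (p : ℤ) * c by linarith, add_smul, one_smul, mul_zsmul,
            hptor, add_zero]
        have hall : ∀ x : geomTorsion W (p : ℤ), σ • x = x := by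
          intro x
          have hx : x ∈ Φ₀ ⊔ Φ₁ := by rw [sup_eq_top_of_ne hΦ₀ hΦ₁ hne]; exact AddSubgroup.mem_top x
          obtain ⟨y, hy, z, hz, rfl⟩ := AddSubgroup.mem_sup.mp hx
          rw [smul_add, hfix Φ₀ k₀ hk₀ h₀ y hy, hfix Φ₁ k₁ hk₁ h₁ z hz]
        have h3 : (3 : ℤ) • v₀ = 0 := by
          have := hσv₀
          rw [hall] at this
          have h' : (4 : ℤ) • v₀ - (1 : ℤ) • v₀ = 0 := by rw [← this, one_smul, sub_self]
          rwa [← sub_smul, show (4 : ℤ) - 1 = 3 by norm_num] at h'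
        have hdvd : addOrderOf v₀ ∣ 3 := by
          apply addOrderOf_dvd_of_nsmul_eq_zero
          rw [← natCast_zsmul]; exact_mod_cast h3
        rw [hordv₀] at hdvd
        have := Nat.le_of_dvd (by norm_num) hdvd
        omega
      · right
        have hle : Φ₁ ≤ X := le_of_scalar_ne_one hk₁ h₁ hσsub
        haveI : Finite X := finite_of_card_eq hX
        exact (AddSubgroup.eq_of_le_of_card_ge hle (by rw [hX, hΦ₁])).symm
    · left
      have hle : Φ₀ ≤ X := le_of_scalar_ne_one hk₀ h₀ hσsub
      haveI : Finite X := finite_of_card_eq hX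
      exact (AddSubgroup.eq_of_le_of_card_ge hle (by rw [hX, hΦ₀])).symm
  -- every inertia element stabilises `X`, hence lies in `H`
  intro τ' hτ'
  rcases hXΦ with h | h
  · exact mem_of_forall_smul_mem hUH hΦ₀ (fun P hP ↦ h ▸ hXstab τ' hτ' P (h ▸ hP))
  · exact mem_of_forall_smul_mem_smul hH2 hUH hΦ₀ hg (fun P hP ↦ by
      rw [← hΦ₁def, ← h] at hP ⊢; exact hXstab τ' hτ' P hP)

end Ordinary


/-! ### §6a The determinant of `ρ̄_{E,p}(σ)` in a basis of `E[p]` is `χ̄_p(σ)` -/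

section Det

variable (W : WeierstrassCurve ℚ) [W.IsElliptic] (p : ℕ) [Fact p.Prime] [NeZero (p : ℚ)]

/-- **`det ρ̄_{E,p} = χ̄_p`, read in a basis `(P₀, P₁)` of `E[p]`** (Weil pairing; Serre 1972
§1.11 / §5.2 (iii), tree `exists_frame_galoisRepTorsion_rat`): if `P₀ ≠ 0`, `P₁ ∉ ℤ P₀`, and
`σ P₀ = a P₀ + c P₁`, `σ P₁ = b P₀ + d P₁`, then `χ̄_p(σ) = a d − b c (mod p)`. (Matrix trick of
the tree's `det_eq_of_sub_mem_line`: `M Q = Q N` with `Q = (e P₀ | e P₁)` invertible.)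
[cite: Serre1972, §1.11 ("le déterminant … est égal au caractère … donnant l'action de G sur μ_p") and §5.2 (iii)] -/
theorem modPCyclotomicCharacter_eq_det_of_basis {P₀ P₁ : geomTorsion W (p : ℤ)} (hP₀ : P₀ ≠ 0)
    (hP₁ : P₁ ∉ AddSubgroup.zmultiples P₀) {σ : absoluteGaloisGroup ℚ} {a b c d : ℤ}
    (h₀ : σ • P₀ = a • P₀ + c • P₁) (h₁ : σ • P₁ = b • P₀ + d • P₁) :
    ((modPCyclotomicCharacterZMod ℚ p σ : (ZMod p)ˣ) : ZMod p) = ((a * d - b * c : ℤ) : ZMod p) := by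
  have hp : p.Prime := Fact.out
  haveI : NeZero p := ⟨hp.ne_zero⟩
  obtain ⟨e, Φ, he, -, hdet, -, -⟩ := W.exists_frame_galoisRepTorsion_rat p
  set M : Matrix (Fin 2) (Fin 2) (ZMod p) :=
    ((Φ (galoisRepTorsion W (p : ℤ) σ) : GL (Fin 2) (ZMod p)) : Matrix (Fin 2) (Fin 2) (ZMod p))
    with hMdef
  have hzs : ∀ (n : ℤ) (x : geomTorsion W (p : ℤ)), e (n • x) = (n : ZMod p) • e x := fun n x ↦ by
    rw [map_zsmul, Int.cast_smul_eq_zsmul]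
  have hMx : ∀ x : geomTorsion W (p : ℤ), M.mulVec (e x) = e (σ • x) := fun x ↦ by
    rw [hMdef, ← he (galoisRepTorsion W (p : ℤ) σ) x]
    rfl
  set x₀ := e P₀ with hx₀
  set x₁ := e P₁ with hx₁
  have hM0 : M.mulVec x₀ = (a : ZMod p) • x₀ + (c : ZMod p) • x₁ := by
    rw [hMx, h₀, map_add, hzs, hzs]
  have hM1 : M.mulVec x₁ = (b : ZMod p) • x₀ + (d : ZMod p) • x₁ := by
    rw [hMx, h₁, map_add, hzs, hzs]
  -- `Q = (x₀ | x₁)` is invertible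
  have hx₀0 : x₀ ≠ 0 := fun h0 ↦ hP₀ (e.injective (h0.trans (map_zero e).symm))
  have hdetQ : x₀ 0 * x₁ 1 - x₁ 0 * x₀ 1 ≠ 0 := by
    intro h
    obtain ⟨γ, hγ⟩ := Serre1972.exists_eq_smul_of_det_eq_zero hx₀0 h
    apply hP₁
    have h1 : e P₁ = e (((γ.val : ℕ) : ℤ) • P₀) := by
      rw [hzs, Int.cast_natCast, ZMod.natCast_zmod_val]
      exact hγ
    rw [e.injective h1]
    exact AddSubgroup.zsmul_mem _ (AddSubgroup.mem_zmultiples P₀) _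
  -- `M Q = Q N`
  have hMQ : M * !![x₀ 0, x₁ 0; x₀ 1, x₁ 1] =
      !![x₀ 0, x₁ 0; x₀ 1, x₁ 1] * !![(a : ZMod p), (b : ZMod p); (c : ZMod p), (d : ZMod p)] := by
    rw [Serre1972.mul_cols, hM0, hM1]
    ext i j
    fin_cases i <;> fin_cases j <;>
      simp [Matrix.mul_apply, Fin.sum_univ_two] <;> ring
  have h := congrArg Matrix.det hMQ
  rw [Matrix.det_mul, Matrix.det_mul, Matrix.det_fin_two_of, Matrix.det_fin_two_of] at h
  have hM : M.det = (a : ZMod p) * d - b * c := by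
    have h' : M.det * (x₀ 0 * x₁ 1 - x₁ 0 * x₀ 1) =
        ((a : ZMod p) * d - b * c) * (x₀ 0 * x₁ 1 - x₁ 0 * x₀ 1) := by
      rw [h]; ring
    exact mul_right_cancel₀ hdetQ h'
  have hd := hdet σ
  rw [← hd, Matrix.GeneralLinearGroup.val_det_apply, ← hMdef, hM]
  push_cast
  ring

end Det

/-! ### §6b `p = 3`: the good ordinary case ("`p = 3`, `K = ℚ(√−3)` … contradicts irreducibility") -/

section Three

/-- `q_v ≠ ℓ` ⇒ `ℓ ∉ 𝔔` for a prime `𝔔` of `\bar ℤ` above `v`. [folklore] -/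
private theorem natCast_not_mem_of_mem_primesAbove_of_ne {v : HeightOneSpectrum (𝓞 ℚ)}
    {𝔔 : Ideal (absIntegers (𝓞 ℚ) ℚ)} (h𝔔 : 𝔔 ∈ v.primesAbove) {ℓ : ℕ} (hℓ : ℓ.Prime)
    (hne : (primesEquiv v : ℕ) ≠ ℓ) : (ℓ : absIntegers (𝓞 ℚ) ℚ) ∉ 𝔔 := by
  intro hmem
  apply hne
  have h1 : ((ℓ : ℕ) : 𝓞 ℚ) ∈ v.asIdeal := by
    rw [h𝔔.2.over, Ideal.mem_comap, map_natCast]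
    exact hmem
  rw [natCast_mem_asIdeal_iff_primesEquiv_dvd] at h1
  exact (Nat.prime_dvd_prime_iff_eq (primesEquiv v).2 hℓ).mp h1

/-- Membership in a normal subgroup is conjugation invariant. [folklore] -/
private theorem conj_mem_iff_of_normal {G : Type*} [Group G] {N : Subgroup G} [hN : N.Normal]
    (s τ : G) : s⁻¹ * τ * s ∈ N ↔ τ ∈ N := by
  constructor
  · intro h
    have := hN.conj_mem _ h s
    rwa [show s * (s⁻¹ * τ * s) * s⁻¹ = τ by group] at this
  · intro h
    have := hN.conj_mem _ h s⁻¹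
    rwa [inv_inv] at this

/-- In `𝔽₃`: `x y = 1 ⟹ x = y`. [folklore] -/
private theorem zmod3_eq_of_mul_eq_one : ∀ x y : ZMod 3, x * y = 1 → x = y := by decide

/-- In `𝔽₃`: `x, y ≠ 0`, `−x y ≠ 1 ⟹ x = y`. [folklore] -/
private theorem zmod3_eq_of_neg_mul_ne_one :
    ∀ x y : ZMod 3, x ≠ 0 → y ≠ 0 → -(x * y) ≠ 1 → x = y := by decide

/-- In `𝔽₃ˣ = {±1}`: `u, w ≠ 1 ⟹ u w = 1`. [folklore] -/
private theorem zmod3_units_mul_eq_one : ∀ u w : (ZMod 3)ˣ, u ≠ 1 → w ≠ 1 → u * w = 1 := by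
  decide

/-- Propositional bookkeeping for `exists_index_two_of_not_iff`. [folklore] -/
private theorem xor_iff_iff_of_not_iff {p q r s : Prop} (h : ¬ (r ↔ s)) :
    Xor ((p ↔ r) ↔ (q ↔ s)) (p ↔ q) := by
  by_cases hr : r <;> by_cases hs : s
  · exact absurd (iff_of_true hr hs) h
  · by_cases hp : p <;> by_cases hq : q <;> simp [Xor, hp, hq, hr, hs]
  · by_cases hp : p <;> by_cases hq : q <;> simp [Xor, hp, hq, hr, hs]
  · exact absurd (iff_of_false hr hs) h

/-- **The third quadratic field**: for two distinct open subgroups `H, V` of index `2` in `Γ_ℚ`,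
`{σ : σ ∈ H ↔ σ ∈ V}` is a third open subgroup of index `2`. [folklore] -/
private theorem exists_index_two_of_not_iff {H V : Subgroup (absoluteGaloisGroup ℚ)}
    (hH2 : H.index = 2) (hV2 : V.index = 2) (hH : IsOpen (H : Set (absoluteGaloisGroup ℚ)))
    (hV : IsOpen (V : Set (absoluteGaloisGroup ℚ))) {σ₁ : absoluteGaloisGroup ℚ}
    (hσ₁ : ¬ (σ₁ ∈ H ↔ σ₁ ∈ V)) :
    ∃ U : Subgroup (absoluteGaloisGroup ℚ), U.index = 2 ∧ IsOpen (U : Set (absoluteGaloisGroup ℚ)) ∧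
      ∀ σ, σ ∈ U ↔ (σ ∈ H ↔ σ ∈ V) := by
  let U : Subgroup (absoluteGaloisGroup ℚ) :=
    { carrier := {σ | σ ∈ H ↔ σ ∈ V}
      mul_mem' := by
        intro a b ha hb
        simp only [Set.mem_setOf_eq] at ha hb ⊢
        rw [Subgroup.mul_mem_iff_of_index_two hH2, Subgroup.mul_mem_iff_of_index_two hV2]
        tauto
      one_mem' := by
        simp only [Set.mem_setOf_eq]
        exact ⟨fun _ ↦ V.one_mem, fun _ ↦ H.one_mem⟩
      inv_mem' := by
        intro a ha
        simp only [Set.mem_setOf_eq] at ha ⊢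
        rw [Subgroup.inv_mem_iff, Subgroup.inv_mem_iff]
        exact ha }
  have hmemU : ∀ σ, σ ∈ U ↔ (σ ∈ H ↔ σ ∈ V) := fun σ ↦ Iff.rfl
  refine ⟨U, ?_, ?_, hmemU⟩
  · rw [Subgroup.index_eq_two_iff]
    refine ⟨σ₁, fun b ↦ ?_⟩
    rw [hmemU, hmemU, Subgroup.mul_mem_iff_of_index_two hH2,
      Subgroup.mul_mem_iff_of_index_two hV2]
    exact xor_iff_iff_of_not_iff hσ₁
  · refine Subgroup.isOpen_mono (H₁ := H ⊓ V) (fun σ hσ ↦ ?_) ?_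
    · rw [hmemU]
      exact ⟨fun _ ↦ (Subgroup.mem_inf.mp hσ).2, fun _ ↦ (Subgroup.mem_inf.mp hσ).1⟩
    · rw [Subgroup.coe_inf]
      exact hH.inter hV

variable {W : WeierstrassCurve ℚ} [W.IsElliptic] [W.IsGloballyMinimal]
  {H : Subgroup (absoluteGaloisGroup ℚ)} {Φ₀ : AddSubgroup (geomTorsion W ((3 : ℕ) : ℤ))}
  (hH2 : H.index = 2) (hUH : MulAction.stabilizer (absoluteGaloisGroup ℚ) Φ₀ = H)
  (hΦ₀ : Nat.card Φ₀ = 3)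
include hH2 hUH hΦ₀

/-- **At a prime above a good ordinary `3`, an inertia element with `χ̄₃ = 1` lies in `H`**:
in the basis `(v₀, w)` of Serre's Prop. 11 the inertia acts by `(χ̄₃ *; 0 1)` (`det ρ̄ = χ̄₃`),
so such a `τ` is unipotent, `τ³ = 1` on `E[3]`, and `τ = τ³ (τ²)⁻¹ ∈ H` (`τ³` fixes `Φ₀`,
squares lie in `H`). [cite: Serre1972, §1.11 Prop. 11 and Cor.]
[cite: MatarNekovar2019, proof of Prop. 5.26 (2) (p. 493)] -/
theorem mem_of_mem_inertia_of_modPCyclotomicCharacter_eq_one [NeZero ((3 : ℕ) : ℚ)]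
    (hgood : W.HasGoodReductionAtPrime 3) (hord : ¬ ((3 : ℕ) : ℤ) ∣ W.frobeniusTrace 3)
    {v : HeightOneSpectrum (𝓞 ℚ)} (hv : (primesEquiv v : ℕ) = 3)
    {𝔓 : Ideal (absIntegers (𝓞 ℚ) ℚ)} (h𝔓 : 𝔓 ∈ v.primesAbove) {τ : absoluteGaloisGroup ℚ}
    (hτ : τ ∈ 𝔓.inertia (absoluteGaloisGroup ℚ)) (hχτ : modPCyclotomicCharacterZMod ℚ 3 τ = 1) :
    τ ∈ H := by
  have hptor : ∀ P : geomTorsion W ((3 : ℕ) : ℤ), ((3 : ℕ) : ℤ) • P = 0 := fun P ↦ by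
    rw [← Subtype.coe_inj, AddSubgroupClass.coe_zsmul, ZeroMemClass.coe_zero]
    exact (Submodule.mem_torsionBy_iff _ _).mp P.2
  have hsmulz : ∀ (σ : absoluteGaloisGroup ℚ) (n : ℤ) (x : geomTorsion W ((3 : ℕ) : ℤ)),
      σ • (n • x) = n • (σ • x) := fun σ n x ↦ map_zsmul (DistribSMul.toAddMonoidHom _ σ) n x
  obtain ⟨v₀, hv₀, hline, -⟩ := exists_ordinaryLine (W := W) hgood hord hv h𝔓
  -- a second basis vector `w ∉ ℤ v₀`
  have hX : AddSubgroup.zmultiples v₀ ≠ ⊤ := by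
    have hordv₀ : addOrderOf v₀ = 3 := addOrderOf_eq_prime (by rw [← natCast_zsmul, hptor]) hv₀
    exact ne_top_of_card_eq (W := W) (p := 3) (by rw [Nat.card_zmultiples, hordv₀])
  obtain ⟨w, hw⟩ : ∃ w : geomTorsion W ((3 : ℕ) : ℤ), w ∉ AddSubgroup.zmultiples v₀ := by
    by_contra! h
    exact hX (eq_top_iff.mpr fun x _ ↦ h x)
  obtain ⟨n₀, hn₀⟩ := hline τ hτ v₀
  obtain ⟨n₁, hn₁⟩ := hline τ hτ w
  have hτv₀ : τ • v₀ = (n₀ + 1) • v₀ + (0 : ℤ) • w := by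
    rw [zero_smul, add_zero, add_smul, one_smul, ← hn₀, sub_add_cancel]
  have hτw : τ • w = n₁ • v₀ + (1 : ℤ) • w := by
    rw [one_smul, ← hn₁, sub_add_cancel]
  have hdetτ := modPCyclotomicCharacter_eq_det_of_basis W 3 hv₀ hw hτv₀ hτw
  rw [hχτ, Units.val_one] at hdetτ
  -- so `τ v₀ = v₀`, and `τ³` acts trivially
  have h3 : ((3 : ℕ) : ℤ) ∣ n₀ := by
    refine (ZMod.intCast_zmod_eq_zero_iff_dvd n₀ 3).mp ?_
    have h1 : (1 : ZMod 3) = (n₀ : ZMod 3) + 1 := hdetτ.trans (by push_cast; ring)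
    linear_combination -h1
  have hτv₀' : τ • v₀ = v₀ := by
    obtain ⟨c, hc⟩ := h3
    rw [hτv₀, zero_smul, add_zero, add_smul, one_smul, hc, mul_zsmul, hptor, zero_add]
  have hτnv : ∀ m : ℤ, τ • (m • v₀) = m • v₀ := fun m ↦ by rw [hsmulz, hτv₀']
  have hτ3 : ∀ x : geomTorsion W ((3 : ℕ) : ℤ), (τ * τ * τ) • x = x := by
    intro x
    obtain ⟨n, hn⟩ := hline τ hτ x
    have hτx : τ • x = x + n • v₀ := by rw [← hn, add_sub_cancel]
    have h3v : n • v₀ + n • v₀ + n • v₀ = 0 := by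
      rw [← add_zsmul, ← add_zsmul, show n + n + n = ((3 : ℕ) : ℤ) * n by push_cast; ring,
        mul_zsmul, hptor]
    simp only [mul_smul, hτx, smul_add, hτnv]
    rw [add_assoc, add_assoc, ← add_assoc (n • v₀), h3v, add_zero]
  have hτ3H : τ * τ * τ ∈ H :=
    mem_of_forall_smul_mem hUH hΦ₀ (fun P hP ↦ by rw [hτ3]; exact hP)
  exact (Subgroup.mul_mem_cancel_left H (mul_self_mem_of_index_two hH2 τ)).mp hτ3H

omit [W.IsGloballyMinimal] in
/-- **The case `H = ker χ̄₃` ("`K = ℚ(√−3)`") is impossible**: in a basis `(P₀, P₁ = g P₀)`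
adapted to `E[3] = Φ₀ ⊕ g Φ₀`, `H` acts diagonally with determinant `χ̄₃ = 1` and `Γ_ℚ ∖ H`
anti-diagonally with determinant `−1`, i.e. by `±1` and `±(0 1; 1 0)` over `𝔽₃`, so the line
`𝔽₃ (P₀ + P₁)` is `Γ_ℚ`-stable — contradicting the irreducibility of `E[3]`
("`ρ(G_ℚ) ≃ (ℤ/2ℤ)^a (a = 1, 2)` … contradicts the irreducibility of `ρ`").
[cite: MatarNekovar2019, proof of Prop. 5.26 (2) (p. 493)] -/
theorem false_of_forall_mem_iff_modPCyclotomicCharacter_eq_one [NeZero ((3 : ℕ) : ℚ)]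
    (hirr : W.HasIrreducibleModPGaloisRep 3) {g : absoluteGaloisGroup ℚ} (hg : g ∉ H)
    (hHV : ∀ σ, σ ∈ H ↔ modPCyclotomicCharacterZMod ℚ 3 σ = 1) : False := by
  haveI := finite_of_card_eq hΦ₀
  have hptor : ∀ P : geomTorsion W ((3 : ℕ) : ℤ), ((3 : ℕ) : ℤ) • P = 0 := fun P ↦ by
    rw [← Subtype.coe_inj, AddSubgroupClass.coe_zsmul, ZeroMemClass.coe_zero]
    exact (Submodule.mem_torsionBy_iff _ _).mp P.2
  have hsmulz : ∀ (σ : absoluteGaloisGroup ℚ) (n : ℤ) (x : geomTorsion W ((3 : ℕ) : ℤ)),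
      σ • (n • x) = n • (σ • x) := fun σ n x ↦ map_zsmul (DistribSMul.toAddMonoidHom _ σ) n x
  have hzmod_dvd : ∀ {m n : ℤ}, ((m : ℤ) : ZMod 3) = n → ((3 : ℕ) : ℤ) ∣ n - m := fun h ↦
    (ZMod.intCast_eq_intCast_iff_dvd_sub _ _ _).mp h
  have hsmul_ne_zero : ∀ (σ : absoluteGaloisGroup ℚ) {x : geomTorsion W ((3 : ℕ) : ℤ)},
      x ≠ 0 → σ • x ≠ 0 := fun σ x hx h ↦ hx (by simpa using congrArg (σ⁻¹ • ·) h)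
  -- the companion line `Φ₁ = g Φ₀` and a basis `(P₀, P₁ = g P₀)` of `E[3] = Φ₀ ⊕ Φ₁`
  set Φ₁ : AddSubgroup (geomTorsion W ((3 : ℕ) : ℤ)) := g • Φ₀ with hΦ₁def
  have hΦ₁ : Nat.card Φ₁ = 3 := by rw [hΦ₁def, card_pointwise_smul, hΦ₀]
  have hne : Φ₁ ≠ Φ₀ := smul_ne_of_not_mem hUH hg
  haveI : Finite Φ₁ := finite_of_card_eq hΦ₁
  have hinf : Φ₀ ⊓ Φ₁ = ⊥ := inf_eq_bot_of_ne hΦ₀ hΦ₁ hne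
  have hnt : 1 < Nat.card Φ₀ := by rw [hΦ₀]; norm_num
  haveI : Nontrivial Φ₀ := Finite.one_lt_card_iff_nontrivial.mp hnt
  obtain ⟨⟨P₀, hP₀⟩, hP₀0⟩ := exists_ne (0 : Φ₀)
  have hP₀0' : P₀ ≠ 0 := fun h ↦ hP₀0 (Subtype.ext h)
  have hΦ₀P : Φ₀ = AddSubgroup.zmultiples P₀ := eq_zmultiples_of_card_eq_prime hΦ₀ hP₀ hP₀0'
  set P₁ : geomTorsion W ((3 : ℕ) : ℤ) := g • P₀ with hP₁def
  have hP₁ : P₁ ∈ Φ₁ := AddSubgroup.smul_mem_pointwise_smul P₀ g Φ₀ hP₀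
  have hP₁0 : P₁ ≠ 0 := hsmul_ne_zero g hP₀0'
  have hΦ₁P : Φ₁ = AddSubgroup.zmultiples P₁ := eq_zmultiples_of_card_eq_prime hΦ₁ hP₁ hP₁0
  have hP₁Φ₀ : P₁ ∉ Φ₀ := fun h ↦ hP₁0 (by
    have : P₁ ∈ Φ₀ ⊓ Φ₁ := AddSubgroup.mem_inf.mpr ⟨h, hP₁⟩
    rwa [hinf, AddSubgroup.mem_bot] at this)
  have hbasis : P₁ ∉ AddSubgroup.zmultiples P₀ := by rw [← hΦ₀P]; exact hP₁Φ₀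
  have hstabH₀ : ∀ σ ∈ H, ∀ P ∈ Φ₀, σ • P ∈ Φ₀ := fun σ hσ ↦
    (mem_stabilizer_iff_forall_smul_mem σ).mp (by rw [hUH]; exact hσ)
  have hstabH₁ : ∀ σ ∈ H, ∀ P ∈ Φ₁, σ • P ∈ Φ₁ := fun σ hσ ↦
    (mem_stabilizer_iff_forall_smul_mem σ).mp
      ((MulAction.mem_stabilizer_iff).mpr (smul_smul_eq_of_mem hH2 hUH hσ))
  have hS0 : P₀ + P₁ ≠ 0 := by
    intro h
    apply hP₁Φ₀
    rw [eq_neg_of_add_eq_zero_right h]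
    exact Φ₀.neg_mem hP₀
  refine absurd (hirr (AddSubgroup.zmultiples (P₀ + P₁)) fun σ P hP ↦ ?_) ?_
  · -- stability: `σ (P₀ + P₁) ∈ ℤ (P₀ + P₁)`
    obtain ⟨m, rfl⟩ := AddSubgroup.mem_zmultiples_iff.mp hP
    rw [hsmulz]
    refine AddSubgroup.zsmul_mem _ ?_ m
    by_cases hσ : σ ∈ H
    · -- `σ ∈ H = V`: `σ P₀ = a P₀`, `σ P₁ = d P₁`, `a d = χ̄₃(σ) = 1`, so `a = d`
      obtain ⟨a, ha⟩ : ∃ a : ℤ, σ • P₀ = a • P₀ := by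
        have h := hstabH₀ σ hσ P₀ hP₀
        rw [hΦ₀P, AddSubgroup.mem_zmultiples_iff] at h
        obtain ⟨a, ha⟩ := h
        exact ⟨a, ha.symm⟩
      obtain ⟨d, hd⟩ : ∃ d : ℤ, σ • P₁ = d • P₁ := by
        have h := hstabH₁ σ hσ P₁ hP₁
        rw [hΦ₁P, AddSubgroup.mem_zmultiples_iff] at h
        obtain ⟨d, hd⟩ := h
        exact ⟨d, hd.symm⟩
      have h₀ : σ • P₀ = a • P₀ + (0 : ℤ) • P₁ := by rw [ha, zero_smul, add_zero]
      have h₁ : σ • P₁ = (0 : ℤ) • P₀ + d • P₁ := by rw [hd, zero_smul, zero_add]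
      have hdet := modPCyclotomicCharacter_eq_det_of_basis W 3 hP₀0' hbasis h₀ h₁
      rw [(hHV σ).mp hσ, Units.val_one] at hdet
      have had : ((a : ℤ) : ZMod 3) = d := by
        apply zmod3_eq_of_mul_eq_one
        rw [hdet]; push_cast; ring
      obtain ⟨k, hk⟩ := hzmod_dvd had
      have hdP₁ : d • P₁ = a • P₁ := by
        rw [show d = a + ((3 : ℕ) : ℤ) * k by rw [← hk]; ring, add_smul, mul_zsmul, hptor,
          add_zero]
      refine AddSubgroup.mem_zmultiples_iff.mpr ⟨a, Eq.symm ?_⟩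
      rw [smul_add σ, ha, hd, hdP₁, smul_add a]
    · -- `σ ∉ H = V`: `σ P₀ = c P₁`, `σ P₁ = b P₀`, `−b c = χ̄₃(σ) = −1`, so `b = c`
      have hσΦ₀ : σ • Φ₀ = Φ₁ := smul_eq_smul_of_not_mem hH2 hUH hg hσ
      have hσΦ₁ : σ • Φ₁ = Φ₀ := smul_smul_eq_of_not_mem hH2 hUH hg hσ
      obtain ⟨c, hc⟩ : ∃ c : ℤ, σ • P₀ = c • P₁ := by
        have h : σ • P₀ ∈ σ • Φ₀ := AddSubgroup.smul_mem_pointwise_smul P₀ σ Φ₀ hP₀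
        rw [hσΦ₀, hΦ₁P, AddSubgroup.mem_zmultiples_iff] at h
        obtain ⟨c, hc⟩ := h
        exact ⟨c, hc.symm⟩
      obtain ⟨b, hb⟩ : ∃ b : ℤ, σ • P₁ = b • P₀ := by
        have h : σ • P₁ ∈ σ • Φ₁ := AddSubgroup.smul_mem_pointwise_smul P₁ σ Φ₁ hP₁
        rw [hσΦ₁, hΦ₀P, AddSubgroup.mem_zmultiples_iff] at h
        obtain ⟨b, hb⟩ := h
        exact ⟨b, hb.symm⟩
      have h₀ : σ • P₀ = (0 : ℤ) • P₀ + c • P₁ := by rw [hc, zero_smul, zero_add]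
      have h₁ : σ • P₁ = b • P₀ + (0 : ℤ) • P₁ := by rw [hb, zero_smul, add_zero]
      have hdet := modPCyclotomicCharacter_eq_det_of_basis W 3 hP₀0' hbasis h₀ h₁
      have hχσ : modPCyclotomicCharacterZMod ℚ 3 σ ≠ 1 := fun h ↦ hσ ((hHV σ).mpr h)
      have hb0 : ((b : ℤ) : ZMod 3) ≠ 0 := by
        intro h
        obtain ⟨k, hk⟩ := (ZMod.intCast_zmod_eq_zero_iff_dvd b 3).mp h
        refine hsmul_ne_zero σ hP₁0 ?_
        rw [hb, hk, mul_zsmul, hptor]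
      have hc0 : ((c : ℤ) : ZMod 3) ≠ 0 := by
        intro h
        obtain ⟨k, hk⟩ := (ZMod.intCast_zmod_eq_zero_iff_dvd c 3).mp h
        refine hsmul_ne_zero σ hP₀0' ?_
        rw [hc, hk, mul_zsmul, hptor]
      have hbc : ((b : ℤ) : ZMod 3) = c := by
        refine zmod3_eq_of_neg_mul_ne_one _ _ hb0 hc0 fun h ↦ hχσ (Units.val_eq_one.mp ?_)
        rw [hdet]; push_cast; linear_combination h
      obtain ⟨k, hk⟩ := hzmod_dvd hbc
      have hcP₁ : c • P₁ = b • P₁ := by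
        rw [show c = b + ((3 : ℕ) : ℤ) * k by rw [← hk]; ring, add_smul, mul_zsmul, hptor,
          add_zero]
      refine AddSubgroup.mem_zmultiples_iff.mpr ⟨b, Eq.symm ?_⟩
      rw [smul_add σ, hc, hb, hcP₁, smul_add b]
      exact add_comm _ _
  · -- `ℤ (P₀ + P₁)` is a line: neither `0` nor `E[3]`
    rintro (h | h)
    · exact hS0 (AddSubgroup.zmultiples_eq_bot.mp h)
    · have hordS : addOrderOf (P₀ + P₁) = 3 :=
        addOrderOf_eq_prime (by rw [← natCast_zsmul, hptor]) hS0
      exact ne_top_of_card_eq (W := W) (p := 3) (Φ₀ := AddSubgroup.zmultiples (P₀ + P₁))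
        (by rw [Nat.card_zmultiples, hordS]) h

/-- **The case `p = 3`, good ordinary reduction at `3`** of Prop. 5.26 (2) — impossible as well
("`p = 3`, `K = ℚ(√−3)` … contradicts the irreducibility of `ρ`"). Here `H = Gal(ℚ̄/K)` is the
stabiliser of the line `Φ₀`, open of index `2`, containing the inertia groups at all `q ≠ 3`
(`haway`). Put `V = ker χ̄₃` (open, index `2`, also containing the inertia at all `q ≠ 3`). By
`mem_of_mem_inertia_of_modPCyclotomicCharacter_eq_one`: if all `I_𝔓 (𝔓 ∣ 3)` lie in `H`, `H`
is unramified everywhere (§0); otherwise some `τ₀ ∈ I_{𝔓₀} ∖ H` has `χ̄₃(τ₀) = −1`, and then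
on every `I_𝔓 (𝔓 ∣ 3)` membership in `H` and in `V` agree (conjugate primes); if `H ≠ V` the
open index-`2` subgroup `{σ : σ ∈ H ↔ σ ∈ V}` contains every inertia group (§0 again), and
`H = V` is `false_of_forall_mem_iff_modPCyclotomicCharacter_eq_one`.
[cite: MatarNekovar2019, proof of Prop. 5.26 (2) (p. 493)]
[cite: Serre1972, §1.11 Prop. 11 and Cor.] -/
theorem false_of_ordinary_three (hirr : W.HasIrreducibleModPGaloisRep 3)
    (hopen : IsOpen (H : Set (absoluteGaloisGroup ℚ))) {g : absoluteGaloisGroup ℚ} (hg : g ∉ H)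
    (hgood : W.HasGoodReductionAtPrime 3) (hord : ¬ ((3 : ℕ) : ℤ) ∣ W.frobeniusTrace 3)
    (haway : ∀ (𝔔 : Ideal (absIntegers (𝓞 ℚ) ℚ)) (v : HeightOneSpectrum (𝓞 ℚ)),
      𝔔 ∈ v.primesAbove → (primesEquiv v : ℕ) ≠ 3 → 𝔔.inertia (absoluteGaloisGroup ℚ) ≤ H) :
    False := by
  haveI : NeZero ((3 : ℕ) : ℚ) := ⟨by norm_num⟩
  -- `V = ker χ̄₃`: open, of index two
  set V : Subgroup (absoluteGaloisGroup ℚ) := (modPCyclotomicCharacterZMod ℚ 3).ker with hVdef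
  have hmemV : ∀ σ, σ ∈ V ↔ modPCyclotomicCharacterZMod ℚ 3 σ = 1 := fun σ ↦ MonoidHom.mem_ker
  have hV2 : V.index = 2 := by
    rw [hVdef, Subgroup.index_ker, MonoidHom.range_eq_top.mpr (fun u ↦
      modPCyclotomicCharacterZMod_rat_surjective 3 u), Subgroup.card_top, Nat.card_eq_fintype_card,
      ZMod.card_units]
  have hVopen : IsOpen (V : Set (absoluteGaloisGroup ℚ)) := by
    obtain ⟨e, Φ, he, -, hdet, -, -⟩ := W.exists_frame_galoisRepTorsion_rat 3
    refine Subgroup.isOpen_mono (H₁ := (galoisRepTorsion W ((3 : ℕ) : ℤ)).ker) (fun σ hσ ↦ ?_)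
      (isOpen_ker_galoisRepTorsion_holds W (n := ((3 : ℕ) : ℤ)) (by norm_num))
    rw [hmemV, ← hdet σ, MonoidHom.mem_ker.mp hσ, map_one, map_one]
  haveI hHn : H.Normal := Subgroup.normal_of_index_eq_two hH2
  haveI hVn : V.Normal := Subgroup.normal_of_index_eq_two hV2
  -- inertia away from `3` lies in `V` too (`χ̄₃` is unramified away from `3`)
  have hawayV : ∀ (𝔔 : Ideal (absIntegers (𝓞 ℚ) ℚ)) (v : HeightOneSpectrum (𝓞 ℚ)),
      𝔔 ∈ v.primesAbove → (primesEquiv v : ℕ) ≠ 3 → 𝔔.inertia (absoluteGaloisGroup ℚ) ≤ V := by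
    intro 𝔔 v h𝔔 hv3 τ hτ
    haveI := h𝔔.1
    rw [hmemV, modPCyclotomicCharacterZMod_eq_modNCyclotomicCharacter]
    exact modNCyclotomicCharacter_eq_one_of_mem_inertia
      (natCast_not_mem_of_mem_primesAbove_of_ne h𝔔 Nat.prime_three hv3) hτ
  -- (B1) `H = V`
  by_cases hHV : ∀ σ, σ ∈ H ↔ σ ∈ V
  · exact false_of_forall_mem_iff_modPCyclotomicCharacter_eq_one hH2 hUH hΦ₀ hirr hg
      (fun σ ↦ (hHV σ).trans (hmemV σ))
  obtain ⟨σ₁, hσ₁⟩ := not_forall.mp hHV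
  -- the place at `3`
  set v₃ : HeightOneSpectrum (𝓞 ℚ) := primesEquiv.symm ⟨3, Nat.prime_three⟩ with hv₃def
  have hv₃ : (primesEquiv v₃ : ℕ) = 3 := by rw [hv₃def, Equiv.apply_symm_apply]
  have heqv₃ : ∀ {v : HeightOneSpectrum (𝓞 ℚ)}, (primesEquiv v : ℕ) = 3 → v = v₃ := fun hv ↦
    primesEquiv.injective (Subtype.ext (hv.trans hv₃.symm))
  have hat3 : ∀ {𝔓 : Ideal (absIntegers (𝓞 ℚ) ℚ)}, 𝔓 ∈ v₃.primesAbove →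
      ∀ τ ∈ 𝔓.inertia (absoluteGaloisGroup ℚ), modPCyclotomicCharacterZMod ℚ 3 τ = 1 → τ ∈ H :=
    fun h𝔓 τ hτ hχτ ↦
      mem_of_mem_inertia_of_modPCyclotomicCharacter_eq_one hH2 hUH hΦ₀ hgood hord hv₃ h𝔓 hτ hχτ
  -- (A) all the inertia groups above `3` lie in `H`: `H` is unramified everywhere
  by_cases hA : ∀ 𝔓 ∈ v₃.primesAbove, 𝔓.inertia (absoluteGaloisGroup ℚ) ≤ H
  · refine not_forall_inertia_le_of_index_two H hopen hH2 fun 𝔓 h𝔓max ↦ ?_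
    obtain ⟨v, h𝔓⟩ := exists_mem_primesAbove_of_isMaximal 𝔓
    by_cases hv : (primesEquiv v : ℕ) = 3
    · rw [heqv₃ hv] at h𝔓
      exact hA 𝔓 h𝔓
    · exact haway 𝔓 v h𝔓 hv
  obtain ⟨𝔓₀, h𝔓₀, hI₀⟩ : ∃ 𝔓₀ ∈ v₃.primesAbove, ¬ 𝔓₀.inertia (absoluteGaloisGroup ℚ) ≤ H := by
    by_contra! h
    exact hA h
  obtain ⟨τ₀, hτ₀, hτ₀H⟩ := SetLike.not_le_iff_exists.mp hI₀
  have hτ₀V : modPCyclotomicCharacterZMod ℚ 3 τ₀ ≠ 1 := fun h ↦ hτ₀H (hat3 h𝔓₀ τ₀ hτ₀ h)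
  -- (B) on every inertia group above `3`, membership in `H` and in `V` agree
  have hat3' : ∀ 𝔓 ∈ v₃.primesAbove, ∀ τ ∈ 𝔓.inertia (absoluteGaloisGroup ℚ),
      (τ ∈ H ↔ τ ∈ V) := by
    have h0 : ∀ τ ∈ 𝔓₀.inertia (absoluteGaloisGroup ℚ), (τ ∈ H ↔ τ ∈ V) := by
      intro τ hτ
      refine ⟨fun hτH ↦ ?_, fun hτV ↦ hat3 h𝔓₀ τ hτ ((hmemV τ).mp hτV)⟩
      rw [hmemV]
      by_contra hχτ
      have h1 : modPCyclotomicCharacterZMod ℚ 3 (τ₀ * τ) = 1 := by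
        rw [map_mul]
        exact zmod3_units_mul_eq_one _ _ hτ₀V hχτ
      have h2 : τ₀ * τ ∈ H := hat3 h𝔓₀ (τ₀ * τ) (Subgroup.mul_mem _ hτ₀ hτ) h1
      exact hτ₀H ((Subgroup.mul_mem_cancel_right H hτH).mp h2)
    intro 𝔓 h𝔓 τ hτ
    obtain ⟨s, hs⟩ :=
      IsDedekindDomain.HeightOneSpectrum.exists_smul_eq_of_mem_primesAbove_holds (K := ℚ) (v := v₃)
        h𝔓₀ h𝔓
    have hτ' : s⁻¹ * τ * s ∈ 𝔓₀.inertia (absoluteGaloisGroup ℚ) := by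
      apply Literature.NumberTheory.GaloisRepresentations.DegreeOnePrimes.conj_mem_inertia_of_mem_inertia_smul
      rw [hs]
      exact hτ
    rw [← conj_mem_iff_of_normal (N := H) s τ, ← conj_mem_iff_of_normal (N := V) s τ]
    exact h0 _ hτ'
  -- (B2) `H ≠ V`: the third index-two subgroup `{σ : σ ∈ H ↔ σ ∈ V}` is unramified everywhere
  obtain ⟨U', hU'2, hU'open, hmemU'⟩ := exists_index_two_of_not_iff hH2 hV2 hopen hVopen hσ₁
  refine not_forall_inertia_le_of_index_two U' hU'open hU'2 fun 𝔓 h𝔓max ↦ ?_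
  obtain ⟨v, h𝔓⟩ := exists_mem_primesAbove_of_isMaximal 𝔓
  intro τ hτ
  rw [hmemU']
  by_cases hv : (primesEquiv v : ℕ) = 3
  · rw [heqv₃ hv] at h𝔓
    exact hat3' 𝔓 h𝔓 τ hτ
  · exact ⟨fun _ ↦ hawayV 𝔓 v h𝔓 hv hτ, fun _ ↦ haway 𝔓 v h𝔓 hv hτ⟩

end Three

/-! ### §6c Assembly -/

section Assembly

variable (W : WeierstrassCurve ℚ) [W.IsElliptic] (K : Type) [Field K] [NumberField K]
  (p : ℕ) [Fact p.Prime]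

/-- **No `Gal(ℚ̄/K)`-stable line** (the core of Prop. 5.26 (2) on a global minimal model): for
`E/ℚ` in global minimal form, `K` quadratic with `(N_E, d_K) = 1`, `p ≠ 2` with `E[p]`
irreducible, no line of `E[p]` is stable under `H = Gal(ℚ̄/K)`. Otherwise `H` would be the
stabiliser of the line (§2) and would contain every inertia group of `Γ_ℚ` (§3 away from `p`;
at `p`: §3 again if `p ∣ N_E`, §5 if `p ≥ 5` is good ordinary; good supersingular `p` is
outright impossible by §4, and so is good ordinary `p = 3` by §6b) — an everywhere unramified
quadratic field (§0).
[cite: MatarNekovar2019, Prop. 5.26 (2) (p. 492) and its proof (p. 493)]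
[cite: Serre1972, §1.11 Prop. 11–12; §4.2 Lemme 2] -/
theorem not_exists_line [W.IsGloballyMinimal] (h2 : Module.finrank ℚ K = 2)
    (hcop : Nat.Coprime (W.conductorNorm ℤ) (NumberField.discr K).natAbs) (hp2 : p ≠ 2)
    (hirr : W.HasIrreducibleModPGaloisRep p)
    {Φ₀ : AddSubgroup (geomTorsion W (p : ℤ))} (hΦ₀ : Nat.card Φ₀ = p)
    (hstab : ∀ σ ∈ (absGaloisRestrict ℚ K).range, ∀ P ∈ Φ₀, σ • P ∈ Φ₀) : False := by
  have hp : p.Prime := Fact.out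
  obtain ⟨hopen, hind⟩ := Automorphic.isOpen_range_absGaloisRestrict_and_index ℚ K
  set H : Subgroup (absoluteGaloisGroup ℚ) := (absGaloisRestrict ℚ K).range with hHdef
  have hH2 : H.index = 2 := hind.trans h2
  have hUH := stabilizer_eq_of_index_two hirr hH2 hΦ₀ hstab
  obtain ⟨g, hg⟩ : ∃ g : absoluteGaloisGroup ℚ, g ∉ H := by
    by_contra! h
    have : H = ⊤ := (Subgroup.eq_top_iff' H).mpr h
    rw [← Subgroup.index_eq_one, hH2] at this
    exact absurd this (by norm_num)
  -- inertia at a place `v` lies in `H` unless `q_v = p` is a prime of good reduction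
  have hin : ∀ (𝔔 : Ideal (absIntegers (𝓞 ℚ) ℚ)) (v : HeightOneSpectrum (𝓞 ℚ)),
      𝔔 ∈ v.primesAbove → ((primesEquiv v : ℕ) ≠ p ∨ (primesEquiv v : ℕ) ∣ W.conductorNorm ℤ) →
      𝔔.inertia (absoluteGaloisGroup ℚ) ≤ H := by
    intro 𝔔 v h𝔔 hv
    haveI : Fact (Nat.Prime (primesEquiv v : ℕ)) := ⟨(primesEquiv v).2⟩
    by_cases hN : (primesEquiv v : ℕ) ∣ W.conductorNorm ℤ
    · exact inertia_le_range_of_dvd_conductorNorm W K h2 hcop hN h𝔔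
    have hgood : W.HasGoodReductionAtPrime (primesEquiv v : ℕ) := by
      by_contra h
      exact hN ((W.dvd_conductorNorm_iff_not_hasGoodReductionAtPrime _).mpr h)
    exact inertia_le_of_good hUH hΦ₀ (hv.resolve_right hN) hgood rfl h𝔔
  by_cases hNp : p ∣ W.conductorNorm ℤ
  · refine not_forall_inertia_le_of_index_two H hopen hH2 fun 𝔓 h𝔓max ↦ ?_
    obtain ⟨v, h𝔓⟩ := exists_mem_primesAbove_of_isMaximal 𝔓
    refine hin 𝔓 v h𝔓 ?_
    by_cases hvp : (primesEquiv v : ℕ) = p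
    · right; rwa [hvp]
    · left; exact hvp
  have hgood : W.HasGoodReductionAtPrime p := by
    by_contra h
    exact hNp ((W.dvd_conductorNorm_iff_not_hasGoodReductionAtPrime _).mpr h)
  by_cases hss : (p : ℤ) ∣ W.frobeniusTrace p
  · exact false_of_supersingular hH2 hUH hΦ₀ hp2 hgood hss
  by_cases hp3 : p = 3
  · subst hp3
    exact false_of_ordinary_three hH2 hUH hΦ₀ hirr hopen hg hgood hss
      (fun 𝔔 v h𝔔 hv ↦ hin 𝔔 v h𝔔 (Or.inl hv))
  refine not_forall_inertia_le_of_index_two H hopen hH2 fun 𝔓 h𝔓max ↦ ?_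
  obtain ⟨v, h𝔓⟩ := exists_mem_primesAbove_of_isMaximal 𝔓
  by_cases hvp : (primesEquiv v : ℕ) = p
  · exact inertia_le_of_ordinary hH2 hUH hΦ₀ (hp.five_le_of_ne_two_of_ne_three hp2 hp3)
      hgood hss hvp h𝔓 hg
  · exact hin 𝔓 v h𝔓 (Or.inl hvp)

/-- `not_exists_line` for `p ≠ 2, 3` (the part of the argument using only Serre's Prop. 11–12).
[cite: MatarNekovar2019, Prop. 5.26 (2) (p. 492)] -/
theorem not_exists_line_of_ne_three [W.IsGloballyMinimal] (h2 : Module.finrank ℚ K = 2)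
    (hcop : Nat.Coprime (W.conductorNorm ℤ) (NumberField.discr K).natAbs) (hp2 : p ≠ 2)
    (_hp3 : p ≠ 3) (hirr : W.HasIrreducibleModPGaloisRep p)
    {Φ₀ : AddSubgroup (geomTorsion W (p : ℤ))} (hΦ₀ : Nat.card Φ₀ = p)
    (hstab : ∀ σ ∈ (absGaloisRestrict ℚ K).range, ∀ P ∈ Φ₀, σ • P ∈ Φ₀) : False :=
  not_exists_line W K p h2 hcop hp2 hirr hΦ₀ hstab

omit [W.IsElliptic] [Fact p.Prime] in
/-- Base change commutes with a change of Weierstrass equation: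
`(C • W)_K = C_K • W_K`. [folklore] -/
private theorem baseChange_smul (C : VariableChange ℚ) :
    (C • W).baseChange K = (C.map (algebraMap ℚ K)) • (W.baseChange K) := by
  rw [baseChange, baseChange, map_variableChange]

/-- **Matar–Nekovář Prop. 5.26 (2), as a theorem**: for `E/ℚ`, a quadratic field `K` with
`(N_E, d_K) = 1`, and a prime `p ≠ 2`: `E[p]` irreducible over `ℚ` ⟹ `E_K[p]` irreducible over
`K`. (Reduction to a global minimal model — irreducibility and `N_E` are isomorphism
invariants — and `not_exists_line` with the line of §1.)
[cite: MatarNekovar2019, Prop. 5.26 (2) (p. 492)] -/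
theorem hasIrreducibleModPGaloisRep_baseChange_of_coprime (h2 : Module.finrank ℚ K = 2)
    (hcop : Nat.Coprime (W.conductorNorm ℤ) (NumberField.discr K).natAbs) (hp2 : p ≠ 2)
    (hirr : W.HasIrreducibleModPGaloisRep p) :
    (W.baseChange K).HasIrreducibleModPGaloisRep p := by
  by_contra hred
  obtain ⟨C, hC⟩ := hasGlobalMinimalModel_rat_holds W
  haveI := hC
  have hirr' : (C • W).HasIrreducibleModPGaloisRep p :=
    (Mazur1978.hasIrreducibleModPGaloisRep_smul_iff W C p).mpr hirr
  have hred' : ¬ ((C • W).baseChange K).HasIrreducibleModPGaloisRep p := by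
    rw [baseChange_smul, Mazur1978.hasIrreducibleModPGaloisRep_smul_iff]
    exact hred
  have hcop' : Nat.Coprime ((C • W).conductorNorm ℤ) (NumberField.discr K).natAbs := by
    rwa [conductorNorm_smul ℤ W C]
  obtain ⟨Φ₀, hΦ₀, hstab⟩ :=
    exists_line_of_not_hasIrreducibleModPGaloisRep_baseChange (C • W) K p hred'
  exact not_exists_line (C • W) K p h2 hcop' hp2 hirr' hΦ₀ hstab

/-- `hasIrreducibleModPGaloisRep_baseChange_of_coprime` for `p ≠ 2, 3`.
[cite: MatarNekovar2019, Prop. 5.26 (2) (p. 492)] -/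
theorem hasIrreducibleModPGaloisRep_baseChange_of_coprime_of_ne_three
    (h2 : Module.finrank ℚ K = 2)
    (hcop : Nat.Coprime (W.conductorNorm ℤ) (NumberField.discr K).natAbs) (hp2 : p ≠ 2)
    (_hp3 : p ≠ 3) (hirr : W.HasIrreducibleModPGaloisRep p) :
    (W.baseChange K).HasIrreducibleModPGaloisRep p :=
  hasIrreducibleModPGaloisRep_baseChange_of_coprime W K p h2 hcop hp2 hirr

end Assembly

/-- **Discharge of the named fact `prop526_hasIrreducibleModPGaloisRep_baseChange`**
(Matar–Nekovář 2019, Prop. 5.26 (2)): for `E/ℚ`, `K` quadratic with `(N_E, d_K) = 1` and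
`p ≠ 2`, `(irr_ℚ) ⟹ (irr_K)`. [cite: MatarNekovar2019, Prop. 5.26 (2) (p. 492)] -/
theorem prop526_hasIrreducibleModPGaloisRep_baseChange_holds :
    prop526_hasIrreducibleModPGaloisRep_baseChange := by
  intro W _ K _ _ h2 hcop p _ hp2 hirr
  exact hasIrreducibleModPGaloisRep_baseChange_of_coprime W K p h2 hcop hp2 hirr

end Literature.NumberTheory.EllipticCurves.MatarNekovar2019

end
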